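import Literature.MathematicalPhysics.PowerSystems.DVOCStabilityCondition
import HarnessLib

/-!
# dVOC networks WITH transmission-line dynamics: the printed composite Lyapunov function
# (Groß–Colombino–Brouillon–Dörfler 2019, §II-A/B, §IV-A/C/E/F, Propositions 4–7)

Topic `Literature/MathematicalPhysics/PowerSystems`, namespace
`Literature.MathematicalPhysics.PowerSystems` with the grouping sub-namespace `DvocLines` (the
transmission-network record). Leaf module: imports `DVOCReducedNetworkLyapunov` (the reduced-order
model (17), `V` (19), Lemma 1, (26), Prop. 3) and `DVOCStabilityCondition` (Lemma 2 from Condition 2,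
the `‖𝒦 − 𝓛‖` bound) and types, on top of them, the FULL-ORDER closed loop (15) of `N` dVOC-controlled
converters interconnected by `M` dynamic RL transmission lines, together with the printed
singular-perturbation Lyapunov construction of §IV-E/F. THREE COLUMNS: everything here is
MODELLED-column mathematics about the printed model (15) (converters = controllable voltage sources
under dVOC (10), balanced three-phase RL lines in a frame rotating at `ω₀`, uniform `ℓ/r` ratio =
Assumption 1, consistent set-points traded for steady-state angles via Prop. 1); no declaration says
that any converter, microgrid or grid is stable. 0 named facts: every `theorem` is PROVED from
Mathlib and the two imported tree files; the operator norms of the print (`‖𝒦 − 𝓛‖`, `‖𝒴‖`)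
and the algebraic-connectivity step enter exactly as in the tree's reduced-order file — as explicit,
instance-checkable bound constants / the (23) property — and §11 discharges them from Condition 2 as
printed using the imported Lemma 2.

Source (held, READ this session on the page; `pNNNN` = PDF page of arXiv:1802.08881):
* [GrossEtAl2019] D. Groß, M. Colombino, J.-S. Brouillon, F. Dörfler, *The effect of transmission-line
  dynamics on grid-forming dispatchable virtual oscillator control*, IEEE Trans. Control Netw. Syst. 6
  (2019) 1148–1160 = arXiv:1802.08881: §II-A (1)–(2), §II-B (3)–(4), Definition 1, Assumption 1,
  `κ := tan⁻¹(ρω₀)`, `L`, `𝓛`, «R(κ)𝒴v = 𝓛v» p0002–p0003; §IV-A (15) p0004; Condition 2, Theorem 2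
  p0005; §IV-C (17), (18) p0006; §IV-E (31), Prop. 4; §IV-F (32), Props. 5, 6, 7, (33)–(35), proof of
  Theorem 2 p0007–p0008; App.: proofs of Props. 5 and 6, eq. (43) p0011. Method: [19] = H. K. Khalil,
  *Nonlinear Systems*, 3rd ed., §11.5 (cited by the source; not needed here beyond the source's text).

> [(2)/(4)] «L_T (d/dt) i = −Z_T i + ℬᵀ v», `Z_T := R_T + ω₀ J_M L_T`; [Def. 1] «i^s(v) := Z_T⁻¹ℬᵀv …
> i^s_o(v) := 𝒴v with 𝒴 := ℬ Z_T⁻¹ ℬᵀ»; [Assumption 1] «ℓ_jk/r_jk = ρ ∈ ℝ_{>0}»; «under Assumption 1,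
> it can be verified that R(κ) i^s_o(v) = R(κ)𝒴v = 𝓛v».
> [(15a)] «(d/dt) v = η(𝒦v − R(κ)ℬ i + αΦ(v)v) =: f_v(v, i)», [(15b)] «(d/dt) i = L_T⁻¹(−Z_T i + ℬᵀ v)
> =: f_i(v, i)».
> [(17)] «(d/dt) v = f_v(v, i^s(v)) = η[(𝒦 − 𝓛)v + αΦ(v)v]»; [(18)] «(d/dt) y = f_i(v, y + i^s(v)) =
> −L_T⁻¹ Z_T y», `y = i − i^s(v)`.
> [(31)] «W(y) := (ρ/2)(yᵀℬᵀℬy + yᵀL_T B_n B_nᵀ L_T y)», `y_o = ℬy`, `y_n = B_nᵀL_T y`, `B_n` spanning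
> `ker B`; [Prop. 4] «(∂W/∂y) f_i(v, y + i^s(v)) ≤ −‖y_o‖² − ‖y_n‖²» (proof: equality, skew terms).
> [(32)] «ν(x) := d W(i − i^s(v)) + (1 − d) V(v)».
> [Prop. 5] «Let β₁ := ‖𝒦 − 𝓛‖⁻¹. For all v and y, (∂V/∂v)[f_v(v, y + i^s(v)) − f_v(v, i^s(v))] ≤
> β₁ψ(v)‖y_o‖» (proof: (43) `f_v(v, y + i^s(v)) − f_v(v, i^s(v)) = f_v(0, y)`, «c ≤ ‖𝒦 − 𝓛‖», «2α₁η ≤ β₁»).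
> [Prop. 6] «β₂ := ρ‖𝒴‖, γ := ηρ‖𝒴‖ … −(∂W/∂y)(∂i^s/∂v) f_v(v, y + i^s(v)) ≤ β₂ψ(v)‖y_o‖ + γ‖y_o‖²»
> (proof: «L_T Z_T⁻¹ = (ρ/(ω₀²ρ² + 1))(I_{2M} − ω₀J_M)», «B_nᵀ L_T Z_T⁻¹ ℬᵀ = 0», «‖f_v(v, i^s(v))‖ ≤ ψ(v)»,
> «‖f_v(0, y)‖ = η‖y_o‖»).
> [Prop. 7] «Let d := β₁/(β₁ + β₂) ∈ ℝ_{(0,1)}. Under Condition 2 … (d/dt)ν ≤ −χ₃(‖x‖_{𝒯₀}) (33)»; proof: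
> «(d/dt)ν ≤ −d‖y_o‖² − d‖y_n‖² + dβ₂ψ(v)‖y_o‖ + dγ‖y_o‖² − (1 − d)α₁ψ(v)² + (1 − d)β₁ψ(v)‖y_o‖
> ≤ −zᵀ M z», `M = [[(1−d)α₁, −((1−d)β₁ + dβ₂)/2, 0], [⋆, (1−γ)d, 0], [0, 0, d]]`,
> (34) «1 < α₁/(α₁γ + β₁β₂) ⟹ M ≻ 0», (35) «η < c/(ρ‖𝒴‖(c + 5‖𝒦 − 𝓛‖))»,
> «Therefore (d/dt)ν(x) < 0 for all (v, i) ∉ 𝒯₀».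

## Rendering and what is proved

* States: `v : DvocState N` (tree), line currents `i : LineState M := (Fin M → ℝ) × (Fin M → ℝ)`,
  `x = (v, i)`. Network `DvocLines N M`: oriented lines `src l → dst l` (= the incidence matrix
  `B`, entries `inc`), admittance magnitudes `a l = ‖Y_l‖`, `ρ`, `ω₀`; `cos κ = 1/√(1+ρ²ω₀²)`,
  `sin κ = ρω₀ cos κ` (`cκ`, `sκ`; = `cos/sin (arctan (ρω₀))`, proved), `r_l = cos κ/‖Y_l‖`,
  `ℓ_l = ρ r_l` so that `Z_l⁻¹ = Y_l = ‖Y_l‖ R(κ)ᵀ`, (1) and Assumption 1 hold by construction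
  (`a_eq_inv_sqrt`, `ind_div_res`). The reduced model's edge weights must MATCH the line set:
  `Consistent W E : ∀ k ≠ j, w k j = Σ_{l joining k,j} ‖Y_l‖` (explicit hypothesis; then the tree's
  `𝓛` is the line Laplacian, `lap₁_eq_lineLap₁`).
* (15a) is typed with `𝒦` in the angle form `DvocReduced.Kang` (= set-point form under Condition 1,
  tree `Kpq_apply_eq_Kang_apply`); (15b) literally as `(−r_l i_l − ω₀ℓ_l J i_l + (ℬᵀv)_l)/ℓ_l`.
* `‖𝒴‖` enters as a constant `Υ` with `AdmittanceBound Υ : ∀u, ‖𝒴u‖² ≤ Υ²‖u‖²` (like the tree's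
  `PhaseErrorBound κ₀` for `‖𝒦 − 𝓛‖`); with `Υ = ‖𝒴‖`, `κ₀ = ‖𝒦 − 𝓛‖` every statement below is
  the printed one. The cycle-space term of `W` is written for ANY cycle matrix `C` (`IsCycle`:
  rows in `ker B`); print's `C = B_nᵀ` is the instance whose rows span `ker B` (only used by print for
  positive-definiteness of `W`, here `Wfun_eq_zero_iff` under the corresponding injectivity hypothesis).
* PROVED, in the printed order: (17) = (15a) at `i = i^s(v)` (`fvVec_iss`, the tree's `field`);
  `f_i(v, i^s(v)) = 0`; (43) (`fv₁_eq`, `fvVec_eq`); (18) (`fi₁_eq_bl₁`); Prop. 4 as an EQUALITY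
  (`dW_blVec`); `B_nᵀL_TZ_T⁻¹ℬᵀ = 0` (`cyc₁_iss`); the exact coupling identity
  `(∂W/∂y)(ẏ) = −‖y_o‖² − ‖y_n‖² − ρ(ℬy)ᵀ𝒴f_v(v,i)` (`dW_blVec_sub_iss`); `‖f(v)‖ ≤ ψ(v)`
  (`sqrt_nsq_field_le`); Prop. 5 (`prop5`, with `β₁ = κ₀⁻¹` and the printed `c ≤ ‖𝒦 − 𝓛‖` as
  hypothesis `c ≤ κ₀`, itself derived from (23) for `N ≥ 2` in `c_le_kappa0`); Prop. 6 (`prop6`);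
  the chain rules along solutions of (15) for `V`, `W`, `ν` (`hasDerivWithinAt_nu`, value `nuDot`);
  Prop. 7's estimate `ν̇ ≤ −zᵀMz` with the printed `M` (`nuDot_le_quadForm`, needs no gain
  condition); (34)–(35) ⟹ `M ≻ 0` with the explicit eigenvalue lower bound `mLB = det/trace > 0`
  (`M_posDef`); hence `ν̇ ≤ −mLB(ψ(v)² + ‖y_o‖²) − d‖y_n‖²` at every state and `ν̇ < 0` off
  `{ψ = 0, y_o = 0, y_n = 0}` (`prop7`, `nuDot_neg`, `hasDerivWithinAt_nu_le`); and the same under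
  Condition 2 AS PRINTED via the imported Lemma 2 (`prop7_of_condition2`, `N ≥ 2`); §12 (append):
  the target set `𝒯` (16) (`InT`), «all elements of 𝒯 are equilibria of (15)»
  (`fullField_eq_zero_of_InT`), `ν ≥ 0` with zero set exactly `𝒯` (`nu_nonneg`, `nu_eq_zero_iff`),
  and Prop. 7 integrated: `ν` is non-increasing along every solution of (15) on `[0, T]`
  (`nu_antitoneOn`, `nu_le_nu_zero_of_condition2`); §13 (append): «‖𝒴‖ = ‖𝓛‖ ≤ 2 d_max»
  (`admittanceBound_of_degree`: the admittance bound needs NO certificate, `Υ = 2d`) and Prop. 7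
  in Prop. 2's printed power-flow form, hypotheses = finitely many data inequalities + the `λ₂`
  certificate (`prop7_of_proposition2`); §14 (append): Prop. 4's first statement in print's terms —
  rows of `C` SPANNING `ker B` (`SpansCycles`, print's `B_n`) and `ℓ_l > 0` give injectivity of
  `y ↦ (ℬy, B_nᵀL_T y)`, hence `W` positive definite and zero set of `ν` = `𝒯`
  (`Wfun_eq_zero_iff_of_spansCycles`, `nu_eq_zero_iff_of_spansCycles`).
* NOT formalized (deliberately, as in the reduced-order file): the `𝒦∞`/`𝒦` packaging of (24)/(33),
  Theorem 1, the measure-zero clause of Theorem 2 (stable-manifold argument, p0008), i.e. the words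
  «almost globally asymptotically stable»; the decrease statement proved here is the part of the
  printed proof that is an inequality between explicit functions of the state.
* TODO(general form): non-uniform `ℓ/r` ratios are outside Assumption 1 and outside this file
  (print: «the main salient features … can still be observed», §V-C, numerics only).
-/

noncomputable section

namespace Literature.MathematicalPhysics.PowerSystems

open Real Finset

/-- State of the `M` transmission-line currents `i = (i_1, …, i_M)`, `i_l ∈ ℝ²` (frame rotating at
`ω₀`), stored like `DvocState` as the pair of coordinate vectors. [cite: GrossEtAl2019, §II-A eq. (2)] -/
abbrev LineState (M : ℕ) : Type := (Fin M → ℝ) × (Fin M → ℝ)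

/-- Transmission-network data of the full-order dVOC model [cite: GrossEtAl2019, §II-A/B]: an
ORIENTED line set (line `l` runs from node `src l` to node `dst l` — the columns of the incidence
matrix `B ∈ {−1,0,1}^{N×M}`), the admittance magnitudes `a l = ‖Y_l‖ = 1/√(r_l² + ω₀²ℓ_l²)` (1)
(the edge weights of the graph), the uniform inductance/resistance ratio `ρ = ℓ_l/r_l` of
Assumption 1, and the nominal frequency `ω₀`. The resistances/inductances are then
`r_l = cos κ/‖Y_l‖`, `ℓ_l = ρ r_l` with `κ = tan⁻¹(ρω₀)` (`res`, `ind` below).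
MODELLED: balanced three-phase RL lines in `αβ`/rotating coordinates, converters = controllable
voltage sources, Assumption 1. -/
structure DvocLines (N M : ℕ) where
  /-- tail node of line `l` (incidence `+1`) -/
  src : Fin M → Fin N
  /-- head node of line `l` (incidence `−1`) -/
  dst : Fin M → Fin N
  /-- admittance magnitude `‖Y_l‖` of line `l` -/
  a : Fin M → ℝ
  /-- uniform `ℓ/r` ratio `ρ` (Assumption 1) -/
  ρ : ℝ
  /-- nominal frequency `ω₀` -/
  ω₀ : ℝ

namespace DvocLines

variable {N M : ℕ} (E : DvocLines N M) (W : DvocReduced N)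

/-! ## §1 Line constants under Assumption 1: `κ = tan⁻¹(ρω₀)`, `r_l`, `ℓ_l`, `‖Y_l‖` -/

/-- `cos κ = 1/√(1 + ρ²ω₀²)` for `κ := tan⁻¹(ρ ω₀)` [cite: GrossEtAl2019, §II-B]. -/
def cκ : ℝ := 1 / Real.sqrt (1 + (E.ρ * E.ω₀) ^ 2)

/-- `sin κ = ρω₀ cos κ` for `κ := tan⁻¹(ρ ω₀)` [cite: GrossEtAl2019, §II-B]. -/
def sκ : ℝ := E.ρ * E.ω₀ * E.cκ

/-- Line resistance `r_l = cos κ / ‖Y_l‖` (from (1) and Assumption 1). [cite: GrossEtAl2019, §II-A/B] -/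
def res (l : Fin M) : ℝ := E.cκ / E.a l

/-- Line inductance `ℓ_l = ρ r_l` (Assumption 1). [cite: GrossEtAl2019, Assumption 1] -/
def ind (l : Fin M) : ℝ := E.ρ * E.res l

/-- `cos κ > 0` (`κ = tan⁻¹(ρω₀) ∈ (−π/2, π/2)`). [cite: GrossEtAl2019, §II-B] -/
theorem cκ_pos : 0 < E.cκ := by
  unfold cκ; positivity

/-- `cos² κ (1 + ρ²ω₀²) = 1`. [cite: GrossEtAl2019, §II-B] -/
theorem cκ_sq_mul : E.cκ ^ 2 * (1 + (E.ρ * E.ω₀) ^ 2) = 1 := by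
  have h : 0 < 1 + (E.ρ * E.ω₀) ^ 2 := by positivity
  unfold cκ
  rw [div_pow, one_pow, Real.sq_sqrt h.le]
  field_simp

/-- `cos² κ + sin² κ = 1`: `R(κ)` is a rotation. [cite: GrossEtAl2019, §II (Notation)] -/
theorem cκ_sq_add_sκ_sq : E.cκ ^ 2 + E.sκ ^ 2 = 1 := by
  have := E.cκ_sq_mul
  unfold sκ
  linear_combination this

/-- `cκ = cos(tan⁻¹(ρω₀))`. [cite: GrossEtAl2019, §II-B] -/
theorem cκ_eq_cos_arctan : E.cκ = Real.cos (Real.arctan (E.ρ * E.ω₀)) := by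
  rw [Real.cos_arctan]; rfl

/-- `sκ = sin(tan⁻¹(ρω₀))`. [cite: GrossEtAl2019, §II-B] -/
theorem sκ_eq_sin_arctan : E.sκ = Real.sin (Real.arctan (E.ρ * E.ω₀)) := by
  rw [Real.sin_arctan]; unfold sκ cκ; ring

/-- Assumption 1 as typed: `ℓ_l / r_l = ρ` (needs `‖Y_l‖ ≠ 0`, `ρ` arbitrary, `cos κ > 0`).
[cite: GrossEtAl2019, Assumption 1] -/
theorem ind_div_res {l : Fin M} (ha : E.a l ≠ 0) : E.ind l / E.res l = E.ρ := by
  have hr : E.res l ≠ 0 := div_ne_zero E.cκ_pos.ne' ha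
  unfold ind
  field_simp

/-- `ℓ_l ‖Y_l‖ = ρ cos κ` — the same for every line (the algebraic content of Assumption 1 that makes
`L_T Z_T⁻¹` a multiple of `I_{2M} − ω₀ J_M`, proof of Prop. 6). [cite: GrossEtAl2019, App. proof of Prop. 6] -/
theorem ind_mul_a {l : Fin M} (ha : E.a l ≠ 0) : E.ind l * E.a l = E.ρ * E.cκ := by
  unfold ind res
  field_simp

/-- (1): `‖Y_l‖ = 1/√(r_l² + ω₀²ℓ_l²)` for positive admittance magnitude. [cite: GrossEtAl2019, eq. (1)] -/
theorem a_eq_inv_sqrt {l : Fin M} (ha : 0 < E.a l) :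
    E.a l = 1 / Real.sqrt (E.res l ^ 2 + (E.ω₀ * E.ind l) ^ 2) := by
  have hc := E.cκ_sq_mul
  have hk := E.cκ_pos
  have h1 : E.res l ^ 2 + (E.ω₀ * E.ind l) ^ 2 = (1 / E.a l) ^ 2 := by
    unfold ind res
    field_simp
    linear_combination hc
  rw [h1, Real.sqrt_sq (by positivity)]
  field_simp

/-! ## §2 Incidence: `ℬ = B ⊗ I₂`, `ℬᵀ v` per line, `ℬ y` per node -/

/-- Incidence entry `B_{k,l} ∈ {−1, 0, 1}` (`+1` at the tail `src l`, `−1` at the head `dst l`).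
[cite: GrossEtAl2019, §II-A] -/
def inc (k : Fin N) (l : Fin M) : ℝ :=
  (if E.src l = k then 1 else 0) - (if E.dst l = k then 1 else 0)

/-- First component of `(ℬᵀ u)_l = u_{src l} − u_{dst l}` (the voltage across line `l`, (2)).
[cite: GrossEtAl2019, eq. (2)] -/
def dV₁ (u : DvocState N) (l : Fin M) : ℝ := u.1 (E.src l) - u.1 (E.dst l)

/-- Second component of `(ℬᵀ u)_l`. [cite: GrossEtAl2019, eq. (2)] -/
def dV₂ (u : DvocState N) (l : Fin M) : ℝ := u.2 (E.src l) - u.2 (E.dst l)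

/-- First component of `(ℬ y)_k = Σ_l B_{k,l} y_l` (output currents `i_o = ℬ i`).
[cite: GrossEtAl2019, §II-A] -/
def nodeCur₁ (y : LineState M) (k : Fin N) : ℝ := ∑ l, E.inc k l * y.1 l

/-- Second component of `(ℬ y)_k`. [cite: GrossEtAl2019, §II-A] -/
def nodeCur₂ (y : LineState M) (k : Fin N) : ℝ := ∑ l, E.inc k l * y.2 l

/-- `ℬ y ∈ ℝ^{2N}`. [cite: GrossEtAl2019, §II-A] -/
def nodeCur (y : LineState M) : DvocState N := (fun k => E.nodeCur₁ y k, fun k => E.nodeCur₂ y k)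

/-- `(ℬᵀ u)_l = Σ_k B_{k,l} u_k`, first component. [cite: GrossEtAl2019, §II-A] -/
theorem dV₁_eq_sum (u : DvocState N) (l : Fin M) : E.dV₁ u l = ∑ k, E.inc k l * u.1 k := by
  simp only [inc, sub_mul, Finset.sum_sub_distrib, ite_mul, one_mul, zero_mul,
    Finset.sum_ite_eq, Finset.mem_univ, if_true, dV₁]

/-- `(ℬᵀ u)_l = Σ_k B_{k,l} u_k`, second component. [cite: GrossEtAl2019, §II-A] -/
theorem dV₂_eq_sum (u : DvocState N) (l : Fin M) : E.dV₂ u l = ∑ k, E.inc k l * u.2 k := by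
  simp only [inc, sub_mul, Finset.sum_sub_distrib, ite_mul, one_mul, zero_mul,
    Finset.sum_ite_eq, Finset.mem_univ, if_true, dV₂]

/-- Adjointness `uᵀ (ℬ y) = (ℬᵀ u)ᵀ y`. [cite: GrossEtAl2019, §II-A] -/
theorem dot_nodeCur (u : DvocState N) (y : LineState M) :
    dvocDot u (E.nodeCur y) = ∑ l, (E.dV₁ u l * y.1 l + E.dV₂ u l * y.2 l) := by
  simp only [dvocDot, nodeCur, nodeCur₁, nodeCur₂, dV₁_eq_sum, dV₂_eq_sum, Finset.mul_sum,
    Finset.sum_mul, ← Finset.sum_add_distrib]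
  rw [Finset.sum_comm]
  exact Finset.sum_congr rfl fun l _ => Finset.sum_congr rfl fun k _ => by ring


/-! ## §3 The quasi-steady-state map `i^s(v) = Z_T⁻¹ ℬᵀ v`, `𝒴 = ℬ Z_T⁻¹ ℬᵀ` and `R(κ) 𝒴 = 𝓛` -/

/-- First component of the steady-state line current `i^s_l(u) = Y_l (ℬᵀu)_l` with
`Y_l = Z_l⁻¹ = ‖Y_l‖ R(κ)ᵀ` under Assumption 1 (Definition 1: `i^s(v) := Z_T⁻¹ ℬᵀ v`).
[cite: GrossEtAl2019, Definition 1] -/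
def iss₁ (u : DvocState N) (l : Fin M) : ℝ := E.a l * (E.cκ * E.dV₁ u l + E.sκ * E.dV₂ u l)

/-- Second component of `i^s_l(u)`. [cite: GrossEtAl2019, Definition 1] -/
def iss₂ (u : DvocState N) (l : Fin M) : ℝ := E.a l * (-E.sκ * E.dV₁ u l + E.cκ * E.dV₂ u l)

/-- `i^s(u) ∈ ℝ^{2M}`. [cite: GrossEtAl2019, Definition 1] -/
def iss (u : DvocState N) : LineState M := (fun l => E.iss₁ u l, fun l => E.iss₂ u l)

/-- `i^s` IS the steady state of (4): `Z_l i^s_l(u) = (ℬᵀu)_l` with `Z_l = r_l I₂ + ω₀ ℓ_l J`,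
`J = R(π/2)`, i.e. `r_l i^s₁ − ω₀ℓ_l i^s₂ = (ℬᵀu)₁`, `r_l i^s₂ + ω₀ℓ_l i^s₁ = (ℬᵀu)₂` (`‖Y_l‖ ≠ 0`).
[cite: GrossEtAl2019, eq. (4) and Definition 1] -/
theorem Z_mul_iss (u : DvocState N) {l : Fin M} (ha : E.a l ≠ 0) :
    E.res l * E.iss₁ u l - E.ω₀ * E.ind l * E.iss₂ u l = E.dV₁ u l ∧
      E.res l * E.iss₂ u l + E.ω₀ * E.ind l * E.iss₁ u l = E.dV₂ u l := by
  have hc := E.cκ_sq_mul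
  constructor
  · unfold iss₁ iss₂ ind res sκ
    field_simp
    linear_combination (E.dV₁ u l) * hc
  · unfold iss₁ iss₂ ind res sκ
    field_simp
    linear_combination (E.dV₂ u l) * hc

/-- The network admittance operator `𝒴 u := ℬ Z_T⁻¹ ℬᵀ u = ℬ i^s(u)` (`i^s_o(v) = 𝒴 v`,
Definition 1). [cite: GrossEtAl2019, Definition 1] -/
def admit (u : DvocState N) : DvocState N := E.nodeCur (E.iss u)

/-- First component of the line-based extended Laplacian `(𝓛 u)_k = Σ_l B_{k,l} ‖Y_l‖ (ℬᵀu)_l`,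
`𝓛 = (B diag(‖Y_l‖) Bᵀ) ⊗ I₂`. [cite: GrossEtAl2019, §II-B] -/
def lineLap₁ (u : DvocState N) (k : Fin N) : ℝ := ∑ l, E.inc k l * E.a l * E.dV₁ u l

/-- Second component of `(𝓛 u)_k`. [cite: GrossEtAl2019, §II-B] -/
def lineLap₂ (u : DvocState N) (k : Fin N) : ℝ := ∑ l, E.inc k l * E.a l * E.dV₂ u l

/-- `R(κ) 𝒴 u = 𝓛 u` («under Assumption 1, it can be verified that `R(κ) i^s_o(v) = R(κ)𝒴v = 𝓛v`»;
here `R(κ) Y_l = ‖Y_l‖ I₂` blockwise). [cite: GrossEtAl2019, §II-B] -/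
theorem rot_admit (u : DvocState N) (k : Fin N) :
    E.cκ * (E.admit u).1 k - E.sκ * (E.admit u).2 k = E.lineLap₁ u k ∧
      E.sκ * (E.admit u).1 k + E.cκ * (E.admit u).2 k = E.lineLap₂ u k := by
  have hcs := E.cκ_sq_add_sκ_sq
  constructor
  · simp only [admit, nodeCur, nodeCur₁, nodeCur₂, iss, iss₁, iss₂, lineLap₁, Finset.mul_sum,
      ← Finset.sum_sub_distrib]
    refine Finset.sum_congr rfl fun l _ => ?_
    linear_combination (E.inc k l * E.a l * E.dV₁ u l) * hcs
  · simp only [admit, nodeCur, nodeCur₁, nodeCur₂, iss, iss₁, iss₂, lineLap₂, Finset.mul_sum,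
      ← Finset.sum_add_distrib]
    refine Finset.sum_congr rfl fun l _ => ?_
    linear_combination (E.inc k l * E.a l * E.dV₂ u l) * hcs

/-- Number of lines joining `k` and `j` weighted by orientation-free incidence:
`[src l = k ∧ dst l = j] + [dst l = k ∧ src l = j]`. [cite: GrossEtAl2019, §II-A] -/
def joins (l : Fin M) (k j : Fin N) : ℝ :=
  (if E.src l = k ∧ E.dst l = j then 1 else 0) + (if E.dst l = k ∧ E.src l = j then 1 else 0)

/-- CONSISTENCY of the reduced model's edge weights with the line set: for `k ≠ j`,
`‖Y_jk‖ = w k j = Σ_{l joining k,j} ‖Y_l‖` (for the printed SIMPLE graph: the admittance magnitude of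
the one line `(j,k) ∈ E`, and `0` off the edge set). [cite: GrossEtAl2019, §II-A (edge weights
`W = {‖Y_l‖}`)] -/
def Consistent (W : DvocReduced N) : Prop :=
  ∀ k j : Fin N, k ≠ j → W.w k j = ∑ l, E.a l * E.joins l k j

/-- Under consistency the reduced model's `𝓛` (`DvocReduced.lap`) IS the line-based Laplacian,
first component. [cite: GrossEtAl2019, §II-B] -/
theorem lap₁_eq_lineLap₁ (h : E.Consistent W) (u : DvocState N) (k : Fin N) :
    W.lap₁ u k = E.lineLap₁ u k := by
  -- replace every weight by the line sum (the diagonal term vanishes on both sides)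
  have hterm : ∀ j, W.w k j * (u.1 k - u.1 j) = (∑ l, E.a l * E.joins l k j) * (u.1 k - u.1 j) := by
    intro j
    by_cases hkj : k = j
    · subst hkj; simp
    · rw [h k j hkj]
  unfold DvocReduced.lap₁
  rw [Finset.sum_congr rfl fun j _ => hterm j]
  simp only [Finset.sum_mul, joins]
  rw [Finset.sum_comm]
  refine Finset.sum_congr rfl fun l _ => ?_
  simp only [mul_add, add_mul, Finset.sum_add_distrib, mul_ite, mul_one, mul_zero, ite_mul,
    zero_mul]
  -- `Σ_j [src l = k ∧ dst l = j] a_l (u_k − u_j) = [src l = k] a_l (u_k − u_{dst l})`, and dually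
  have e1 : (∑ j, if E.src l = k ∧ E.dst l = j then E.a l * (u.1 k - u.1 j) else 0)
      = if E.src l = k then E.a l * (u.1 k - u.1 (E.dst l)) else 0 := by
    by_cases hs : E.src l = k
    · simp only [hs, true_and, if_true]
      rw [Finset.sum_ite_eq Finset.univ (E.dst l) (fun j => E.a l * (u.1 k - u.1 j))]
      simp
    · simp [hs]
  have e2 : (∑ j, if E.dst l = k ∧ E.src l = j then E.a l * (u.1 k - u.1 j) else 0)
      = if E.dst l = k then E.a l * (u.1 k - u.1 (E.src l)) else 0 := by
    by_cases hd : E.dst l = k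
    · simp only [hd, true_and, if_true]
      rw [Finset.sum_ite_eq Finset.univ (E.src l) (fun j => E.a l * (u.1 k - u.1 j))]
      simp
    · simp [hd]
  rw [e1, e2]
  unfold inc dV₁
  by_cases hs : E.src l = k <;> by_cases hd : E.dst l = k
  · simp only [hs, hd, if_true]; ring
  · simp only [hs, hd, if_true, if_false]; subst hs; ring
  · simp only [hs, hd, if_true, if_false]; subst hd; ring
  · simp [hs, hd]

/-- Under consistency `DvocReduced.lap₂ = lineLap₂`. [cite: GrossEtAl2019, §II-B] -/
theorem lap₂_eq_lineLap₂ (h : E.Consistent W) (u : DvocState N) (k : Fin N) :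
    W.lap₂ u k = E.lineLap₂ u k := by
  -- same computation on the second coordinates: apply the first-coordinate lemma to the swap
  have := E.lap₁_eq_lineLap₁ W h (u.2, u.1) k
  simpa [DvocReduced.lap₁, DvocReduced.lap₂, lineLap₁, lineLap₂, dV₁, dV₂] using this


/-! ## §4 The full-order closed loop (15) and its relation to the reduced model (17) -/

/-- (15a), first component: `v̇_k = η (K_k v_k − R(κ)(ℬ i)_k + α Φ_k(v_k) v_k)` with `K_k` in the
angle form (`DvocReduced.Kang`, = the set-point form under Condition 1 by Prop. 1) and
`R(κ)(p, q) = (cos κ p − sin κ q, sin κ p + cos κ q)`. [cite: GrossEtAl2019, eq. (15a)] -/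
def fv₁ (v : DvocState N) (i : LineState M) (k : Fin N) : ℝ :=
  W.η * (W.Kang₁ v k - (E.cκ * E.nodeCur₁ i k - E.sκ * E.nodeCur₂ i k) + W.α * W.Phi v k * v.1 k)

/-- (15a), second component. [cite: GrossEtAl2019, eq. (15a)] -/
def fv₂ (v : DvocState N) (i : LineState M) (k : Fin N) : ℝ :=
  W.η * (W.Kang₂ v k - (E.sκ * E.nodeCur₁ i k + E.cκ * E.nodeCur₂ i k) + W.α * W.Phi v k * v.2 k)

/-- `f_v(v, i) ∈ ℝ^{2N}`. [cite: GrossEtAl2019, eq. (15a)] -/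
def fvVec (v : DvocState N) (i : LineState M) : DvocState N :=
  (fun k => E.fv₁ W v i k, fun k => E.fv₂ W v i k)

/-- (15b) = (4), first component: `ℓ_l (d/dt) i_l = −r_l i_l − ω₀ ℓ_l J i_l + (ℬᵀ v)_l`, i.e.
`(d/dt) i_l = L_T⁻¹(−Z_T i + ℬᵀ v)_l`, `Z_T = R_T + ω₀ J_M L_T`, `J(p,q) = (−q, p)`.
[cite: GrossEtAl2019, eq. (4), (15b)] -/
def fi₁ (v : DvocState N) (i : LineState M) (l : Fin M) : ℝ :=
  (-E.res l * i.1 l + E.ω₀ * E.ind l * i.2 l + E.dV₁ v l) / E.ind l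

/-- (15b), second component. [cite: GrossEtAl2019, eq. (15b)] -/
def fi₂ (v : DvocState N) (i : LineState M) (l : Fin M) : ℝ :=
  (-E.res l * i.2 l - E.ω₀ * E.ind l * i.1 l + E.dV₂ v l) / E.ind l

/-- `f_i(v, i) ∈ ℝ^{2M}`. [cite: GrossEtAl2019, eq. (15b)] -/
def fiVec (v : DvocState N) (i : LineState M) : LineState M :=
  (fun l => E.fi₁ v i l, fun l => E.fi₂ v i l)

/-- The full-order field `f(x) = (f_v(v,i), f_i(v,i))` on `x = (v, i) ∈ ℝ^{2N+2M}`.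
[cite: GrossEtAl2019, §IV-A eq. (15)] -/
def fullField (x : DvocState N × LineState M) : DvocState N × LineState M :=
  (E.fvVec W x.1 x.2, E.fiVec x.1 x.2)

/-- Solutions of the full-order system (15) on a time set `s` (tree convention `HasDerivWithinAt`).
[cite: GrossEtAl2019, eq. (15)] -/
def IsSolutionOn (γ : ℝ → DvocState N × LineState M) (s : Set ℝ) : Prop :=
  ∀ t ∈ s, HasDerivWithinAt γ (E.fullField W (γ t)) s t

/-- Deviation of the line currents from their quasi-steady state, `y := i − i^s(v)`.
[cite: GrossEtAl2019, §IV-C] -/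
def dev (v : DvocState N) (i : LineState M) : LineState M := i - E.iss v

/-- **(17) is (15a) on the quasi-steady-state manifold**: `f_v(v, i^s(v)) = η[(𝒦 − 𝓛)v + αΦ(v)v]`
= the tree's reduced field `DvocReduced.field` (uses `R(κ)𝒴 = 𝓛`, Prop. 1 and consistency).
[cite: GrossEtAl2019, eq. (17)] -/
theorem fvVec_iss (h : E.Consistent W) (v : DvocState N) : E.fvVec W v (E.iss v) = W.field v := by
  refine Prod.ext (funext fun k => ?_) (funext fun k => ?_)
  · have h1 := (E.rot_admit v k).1
    have h2 := E.lap₁_eq_lineLap₁ W h v k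
    have h3 := W.eθ₁_eq_K_sub_lap v k
    simp only [fvVec, fv₁, DvocReduced.field, DvocReduced.g₁]
    simp only [admit] at h1
    rw [h3, h2, ← h1]
    simp only [nodeCur]
  · have h1 := (E.rot_admit v k).2
    have h2 := E.lap₂_eq_lineLap₂ W h v k
    have h3 := W.eθ₂_eq_K_sub_lap v k
    simp only [fvVec, fv₂, DvocReduced.field, DvocReduced.g₂]
    simp only [admit] at h1
    rw [h3, h2, ← h1]
    simp only [nodeCur]

/-- `y_o := i_o − i^s_o(v) = ℬ y` («we define y_o := i_o − i^s_o(v) = ℬy»): `ℬ(i − i^s(v)) = ℬ i − 𝒴 v`,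
first components. [cite: GrossEtAl2019, §IV-E] -/
theorem nodeCur₁_dev (v : DvocState N) (i : LineState M) (k : Fin N) :
    E.nodeCur₁ (E.dev v i) k = E.nodeCur₁ i k - (E.admit v).1 k := by
  simp only [nodeCur₁, dev, admit, nodeCur, iss, Prod.fst_sub, Pi.sub_apply, mul_sub,
    Finset.sum_sub_distrib]

/-- `y_o = ℬ(i − i^s(v)) = ℬ i − 𝒴 v`, second components. [cite: GrossEtAl2019, §IV-E] -/
theorem nodeCur₂_dev (v : DvocState N) (i : LineState M) (k : Fin N) :
    E.nodeCur₂ (E.dev v i) k = E.nodeCur₂ i k - (E.admit v).2 k := by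
  simp only [nodeCur₂, dev, admit, nodeCur, iss, Prod.snd_sub, Pi.sub_apply, mul_sub,
    Finset.sum_sub_distrib]

/-- **(43)**: `f_v(v, y + i^s(v)) − f_v(v, i^s(v)) = f_v(0, y)`, i.e. `f_v(v, i) = f(v) − η R(κ) ℬ y`
with `y = i − i^s(v)` and `f` the reduced field (17); first component. (Print writes `f_v(0,y) =
η R(κ) ℬ y`; with the sign convention of (15a) it is `−η R(κ) ℬ y` — only its norm `η‖y_o‖` is used.)
[cite: GrossEtAl2019, App. proof of Prop. 5, eq. (43)] -/
theorem fv₁_eq (h : E.Consistent W) (v : DvocState N) (i : LineState M) (k : Fin N) :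
    E.fv₁ W v i k = W.η * W.g₁ v k
      - W.η * (E.cκ * E.nodeCur₁ (E.dev v i) k - E.sκ * E.nodeCur₂ (E.dev v i) k) := by
  have hf := congrArg (fun u : DvocState N => u.1 k) (E.fvVec_iss W h v)
  simp only [fvVec, DvocReduced.field] at hf
  rw [nodeCur₁_dev, nodeCur₂_dev]
  simp only [fv₁, admit, nodeCur] at hf ⊢
  linear_combination hf

/-- (43), second component. [cite: GrossEtAl2019, eq. (43)] -/
theorem fv₂_eq (h : E.Consistent W) (v : DvocState N) (i : LineState M) (k : Fin N) :
    E.fv₂ W v i k = W.η * W.g₂ v k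
      - W.η * (E.sκ * E.nodeCur₁ (E.dev v i) k + E.cκ * E.nodeCur₂ (E.dev v i) k) := by
  have hf := congrArg (fun u : DvocState N => u.2 k) (E.fvVec_iss W h v)
  simp only [fvVec, DvocReduced.field] at hf
  rw [nodeCur₁_dev, nodeCur₂_dev]
  simp only [fv₂, admit, nodeCur] at hf ⊢
  linear_combination hf

/-! ## §5 The boundary-layer system (18) and the deviation dynamics -/

/-- (18), first component: the boundary-layer field `−L_T⁻¹ Z_T y = −(1/ρ) y − ω₀ J_M y` (Assumption 1:
`L_T⁻¹ Z_T = (1/ρ) I_{2M} + ω₀ J_M`). [cite: GrossEtAl2019, eq. (18)] -/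
def bl₁ (y : LineState M) (l : Fin M) : ℝ := -(1 / E.ρ) * y.1 l + E.ω₀ * y.2 l

/-- (18), second component. [cite: GrossEtAl2019, eq. (18)] -/
def bl₂ (y : LineState M) (l : Fin M) : ℝ := -(1 / E.ρ) * y.2 l - E.ω₀ * y.1 l

/-- The boundary-layer field `y ↦ −L_T⁻¹ Z_T y`. [cite: GrossEtAl2019, eq. (18)] -/
def blVec (y : LineState M) : LineState M := (fun l => E.bl₁ y l, fun l => E.bl₂ y l)

/-- **(18)**: `f_i(v, y + i^s(v)) = −L_T⁻¹ Z_T y` — in the deviation coordinate the line dynamics are the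
boundary-layer system driven by nothing but `y` (the `v`-terms cancel because `Z_T i^s(v) = ℬᵀ v`);
first component (`‖Y_l‖ ≠ 0`, `ρ ≠ 0`). [cite: GrossEtAl2019, eq. (18)] -/
theorem fi₁_eq_bl₁ (hρ : E.ρ ≠ 0) (v : DvocState N) (i : LineState M) {l : Fin M} (ha : E.a l ≠ 0) :
    E.fi₁ v i l = E.bl₁ (E.dev v i) l := by
  have hz := (E.Z_mul_iss v ha).1
  have hr : E.res l ≠ 0 := div_ne_zero E.cκ_pos.ne' ha
  have hi : E.ind l ≠ 0 := mul_ne_zero hρ hr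
  simp only [fi₁, bl₁, dev, iss, Prod.fst_sub, Prod.snd_sub, Pi.sub_apply]
  rw [div_eq_iff hi]
  unfold ind at hz hi ⊢
  field_simp
  linear_combination (-1 : ℝ) * hz

/-- (18), second component. [cite: GrossEtAl2019, eq. (18)] -/
theorem fi₂_eq_bl₂ (hρ : E.ρ ≠ 0) (v : DvocState N) (i : LineState M) {l : Fin M} (ha : E.a l ≠ 0) :
    E.fi₂ v i l = E.bl₂ (E.dev v i) l := by
  have hz := (E.Z_mul_iss v ha).2
  have hr : E.res l ≠ 0 := div_ne_zero E.cκ_pos.ne' ha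
  have hi : E.ind l ≠ 0 := mul_ne_zero hρ hr
  simp only [fi₂, bl₂, dev, iss, Prod.fst_sub, Prod.snd_sub, Pi.sub_apply]
  rw [div_eq_iff hi]
  unfold ind at hz hi ⊢
  field_simp
  linear_combination (-1 : ℝ) * hz

/-- `f_i(v, i^s(v)) = 0`: the quasi-steady-state currents are the equilibrium of (15b) for frozen `v`.
[cite: GrossEtAl2019, Definition 1] -/
theorem fiVec_iss (hρ : E.ρ ≠ 0) (ha : ∀ l, E.a l ≠ 0) (v : DvocState N) :
    E.fiVec v (E.iss v) = 0 := by
  refine Prod.ext (funext fun l => ?_) (funext fun l => ?_)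
  · have := E.fi₁_eq_bl₁ hρ v (E.iss v) (ha l)
    simpa [fiVec, bl₁, dev] using this
  · have := E.fi₂_eq_bl₂ hρ v (E.iss v) (ha l)
    simpa [fiVec, bl₂, dev] using this


/-! ## §6 The boundary-layer Lyapunov function `W` (31) and Proposition 4 -/

section cycle

variable {M₀ : ℕ} (C : Fin M₀ → Fin M → ℝ)

/-- A CYCLE MATRIX: every row of `C ∈ ℝ^{M₀×M}` lies in `ker B` (`C Bᵀ = 0`, i.e. `B Cᵀ = 0`). Print
takes `C = B_nᵀ` with the columns of `B_n ∈ ℝ^{M×M₀}` SPANNING `ker B` (`M₀ = M − N + 1` for a connected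
graph); everything below except positive-definiteness of `W` holds for any cycle matrix.
[cite: GrossEtAl2019, §IV-E] -/
def IsCycle (C : Fin M₀ → Fin M → ℝ) : Prop := ∀ (c : Fin M₀) (k : Fin N), ∑ l, C c l * E.inc k l = 0

/-- First component of `(y_n)_c = (ℬ_nᵀ L_T y)_c = Σ_l C_{c,l} ℓ_l y_l` (print `y_n = B_nᵀ L_T y` with
`B_n := B_n ⊗ I₂`). [cite: GrossEtAl2019, §IV-E] -/
def cyc₁ (y : LineState M) (c : Fin M₀) : ℝ := ∑ l, C c l * E.ind l * y.1 l

/-- Second component of `(y_n)_c`. [cite: GrossEtAl2019, §IV-E] -/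
def cyc₂ (y : LineState M) (c : Fin M₀) : ℝ := ∑ l, C c l * E.ind l * y.2 l

/-- `‖y_o‖² = ‖ℬ y‖²`. [cite: GrossEtAl2019, §IV-E] -/
def normYoSq (y : LineState M) : ℝ := ∑ k, dvocNsq (E.nodeCur y) k

/-- `‖y_n‖² = ‖ℬ_nᵀ L_T y‖²`. [cite: GrossEtAl2019, §IV-E] -/
def normYnSq (y : LineState M) : ℝ := ∑ c, (E.cyc₁ C y c ^ 2 + E.cyc₂ C y c ^ 2)

/-- **(31)** `W(y) := (ρ/2)(yᵀ ℬᵀ ℬ y + yᵀ L_T B_n B_nᵀ L_T y) = (ρ/2)(‖y_o‖² + ‖y_n‖²)`.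
[cite: GrossEtAl2019, eq. (31)] -/
def Wfun (y : LineState M) : ℝ := E.ρ / 2 * (E.normYoSq y + E.normYnSq C y)

/-- The directional derivative `(∂W/∂y)(y) z = ρ((ℬy)ᵀ(ℬz) + (B_nᵀL_T y)ᵀ(B_nᵀL_T z))` of the quadratic
`W` at `y` along `z`. [cite: GrossEtAl2019, §IV-E] -/
def dW (y z : LineState M) : ℝ :=
  E.ρ * (dvocDot (E.nodeCur y) (E.nodeCur z)
    + ∑ c, (E.cyc₁ C y c * E.cyc₁ C z c + E.cyc₂ C y c * E.cyc₂ C z c))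

/-- `‖y_o‖² ≥ 0`. [cite: GrossEtAl2019, §IV-E] -/
theorem normYoSq_nonneg (y : LineState M) : 0 ≤ E.normYoSq y :=
  Finset.sum_nonneg fun k _ => by unfold dvocNsq; positivity

/-- `‖y_n‖² ≥ 0`. [cite: GrossEtAl2019, §IV-E] -/
theorem normYnSq_nonneg (y : LineState M) : 0 ≤ E.normYnSq C y :=
  Finset.sum_nonneg fun c _ => by positivity

/-- `W ≥ 0` for `ρ ≥ 0`. [cite: GrossEtAl2019, Prop. 4] -/
theorem Wfun_nonneg (hρ : 0 ≤ E.ρ) (y : LineState M) : 0 ≤ E.Wfun C y := by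
  unfold Wfun
  have := E.normYoSq_nonneg y
  have := E.normYnSq_nonneg C y
  positivity

/-- Positive-definiteness of `W` (first statement of Prop. 4), in the form print proves it: IF the
stacked map `y ↦ (ℬ y, B_nᵀ L_T y)` is injective (print: `B_n` has full rank and spans `ker B`) and
`ρ > 0`, then `W(y) = 0 ↔ y = 0`. [cite: GrossEtAl2019, Prop. 4] -/
theorem Wfun_eq_zero_iff (hρ : 0 < E.ρ)
    (hinj : ∀ y : LineState M, E.nodeCur y = 0 → (∀ c, E.cyc₁ C y c = 0 ∧ E.cyc₂ C y c = 0) → y = 0)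
    (y : LineState M) : E.Wfun C y = 0 ↔ y = 0 := by
  constructor
  · intro h
    have h1 := E.normYoSq_nonneg y
    have h2 := E.normYnSq_nonneg C y
    have hsum : E.normYoSq y + E.normYnSq C y = 0 := by
      unfold Wfun at h
      rcases mul_eq_zero.1 h with h | h
      · exact absurd h (by positivity)
      · exact h
    have ho : E.normYoSq y = 0 := by linarith
    have hn : E.normYnSq C y = 0 := by linarith
    refine hinj y ?_ fun c => ?_
    · have hk := (Finset.sum_eq_zero_iff_of_nonneg fun k _ => by unfold dvocNsq; positivity).1 ho
      refine Prod.ext (funext fun k => ?_) (funext fun k => ?_)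
      · have := hk k (Finset.mem_univ k)
        unfold dvocNsq at this
        have : (E.nodeCur y).1 k = 0 := by nlinarith [sq_nonneg ((E.nodeCur y).1 k), sq_nonneg ((E.nodeCur y).2 k)]
        simpa using this
      · have := hk k (Finset.mem_univ k)
        unfold dvocNsq at this
        have : (E.nodeCur y).2 k = 0 := by nlinarith [sq_nonneg ((E.nodeCur y).1 k), sq_nonneg ((E.nodeCur y).2 k)]
        simpa using this
    · have hc := (Finset.sum_eq_zero_iff_of_nonneg fun c _ => by positivity).1 hn c (Finset.mem_univ c)
      constructor <;> nlinarith [sq_nonneg (E.cyc₁ C y c), sq_nonneg (E.cyc₂ C y c)]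
  · rintro rfl
    simp [Wfun, normYoSq, normYnSq, nodeCur, nodeCur₁, nodeCur₂, cyc₁, cyc₂, dvocNsq]

/-- `ℬ` commutes with `J_M`: `(ℬ (ω₀-rotation part of (18)))` pairs to zero with `ℬ y` — the skew term
`ρ ω₀ yᵀ ℬᵀ ℬ J_M y = 0` of the printed proof, componentwise. [cite: GrossEtAl2019, proof of Prop. 4] -/
theorem nodeCur_blVec (y : LineState M) (k : Fin N) :
    E.nodeCur₁ (E.blVec y) k = -(1 / E.ρ) * E.nodeCur₁ y k + E.ω₀ * E.nodeCur₂ y k ∧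
      E.nodeCur₂ (E.blVec y) k = -(1 / E.ρ) * E.nodeCur₂ y k - E.ω₀ * E.nodeCur₁ y k := by
  constructor
  · simp only [nodeCur₁, nodeCur₂, blVec, bl₁, Finset.mul_sum, ← Finset.sum_add_distrib]
    exact Finset.sum_congr rfl fun l _ => by ring
  · simp only [nodeCur₁, nodeCur₂, blVec, bl₂, Finset.mul_sum, ← Finset.sum_sub_distrib]
    exact Finset.sum_congr rfl fun l _ => by ring

/-- `B_nᵀ L_T` commutes with `J_M` likewise. [cite: GrossEtAl2019, proof of Prop. 4] -/
theorem cyc_blVec (y : LineState M) (c : Fin M₀) :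
    E.cyc₁ C (E.blVec y) c = -(1 / E.ρ) * E.cyc₁ C y c + E.ω₀ * E.cyc₂ C y c ∧
      E.cyc₂ C (E.blVec y) c = -(1 / E.ρ) * E.cyc₂ C y c - E.ω₀ * E.cyc₁ C y c := by
  constructor
  · simp only [cyc₁, cyc₂, blVec, bl₁, Finset.mul_sum, ← Finset.sum_add_distrib]
    exact Finset.sum_congr rfl fun l _ => by ring
  · simp only [cyc₁, cyc₂, blVec, bl₂, Finset.mul_sum, ← Finset.sum_sub_distrib]
    exact Finset.sum_congr rfl fun l _ => by ring

/-- **Proposition 4** (decrease of `W` along the boundary-layer system (18)):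
`(∂W/∂y) f_i(v, y + i^s(v)) = −‖y_o‖² − ‖y_n‖²` — EXACTLY (the `ω₀ J_M` terms are skew and vanish),
`ρ ≠ 0`. [cite: GrossEtAl2019, Prop. 4] -/
theorem dW_blVec (hρ : E.ρ ≠ 0) (y : LineState M) :
    E.dW C y (E.blVec y) = -(E.normYoSq y + E.normYnSq C y) := by
  have ho : dvocDot (E.nodeCur y) (E.nodeCur (E.blVec y)) = -(1 / E.ρ) * E.normYoSq y := by
    simp only [dvocDot, normYoSq, dvocNsq, nodeCur, Finset.mul_sum]
    refine Finset.sum_congr rfl fun k _ => ?_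
    obtain ⟨h1, h2⟩ := E.nodeCur_blVec y k
    rw [h1, h2]; ring
  have hn : (∑ c, (E.cyc₁ C y c * E.cyc₁ C (E.blVec y) c + E.cyc₂ C y c * E.cyc₂ C (E.blVec y) c))
      = -(1 / E.ρ) * E.normYnSq C y := by
    simp only [normYnSq, Finset.mul_sum]
    refine Finset.sum_congr rfl fun c _ => ?_
    obtain ⟨h1, h2⟩ := E.cyc_blVec C y c
    rw [h1, h2]; ring
  unfold dW
  rw [ho, hn]
  field_simp
  ring

/-- `dW` is linear in the direction: `dW(y)(z − z') = dW(y) z − dW(y) z'`. [folklore] -/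
private theorem dW_sub (y z z' : LineState M) : E.dW C y (z - z') = E.dW C y z - E.dW C y z' := by
  have h1 : ∀ k, E.nodeCur₁ (z - z') k = E.nodeCur₁ z k - E.nodeCur₁ z' k := fun k => by
    simp only [nodeCur₁, Prod.fst_sub, Pi.sub_apply, mul_sub, Finset.sum_sub_distrib]
  have h2 : ∀ k, E.nodeCur₂ (z - z') k = E.nodeCur₂ z k - E.nodeCur₂ z' k := fun k => by
    simp only [nodeCur₂, Prod.snd_sub, Pi.sub_apply, mul_sub, Finset.sum_sub_distrib]
  have h3 : ∀ c, E.cyc₁ C (z - z') c = E.cyc₁ C z c - E.cyc₁ C z' c := fun c => by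
    simp only [cyc₁, Prod.fst_sub, Pi.sub_apply, mul_sub, Finset.sum_sub_distrib]
  have h4 : ∀ c, E.cyc₂ C (z - z') c = E.cyc₂ C z c - E.cyc₂ C z' c := fun c => by
    simp only [cyc₂, Prod.snd_sub, Pi.sub_apply, mul_sub, Finset.sum_sub_distrib]
  have hA : (∑ k, (E.nodeCur₁ y k * (E.nodeCur₁ z k - E.nodeCur₁ z' k)
      + E.nodeCur₂ y k * (E.nodeCur₂ z k - E.nodeCur₂ z' k)))
      = (∑ k, (E.nodeCur₁ y k * E.nodeCur₁ z k + E.nodeCur₂ y k * E.nodeCur₂ z k))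
        - ∑ k, (E.nodeCur₁ y k * E.nodeCur₁ z' k + E.nodeCur₂ y k * E.nodeCur₂ z' k) := by
    rw [← Finset.sum_sub_distrib]
    exact Finset.sum_congr rfl fun k _ => by ring
  have hB : (∑ c, (E.cyc₁ C y c * (E.cyc₁ C z c - E.cyc₁ C z' c)
      + E.cyc₂ C y c * (E.cyc₂ C z c - E.cyc₂ C z' c)))
      = (∑ c, (E.cyc₁ C y c * E.cyc₁ C z c + E.cyc₂ C y c * E.cyc₂ C z c))
        - ∑ c, (E.cyc₁ C y c * E.cyc₁ C z' c + E.cyc₂ C y c * E.cyc₂ C z' c) := by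
    rw [← Finset.sum_sub_distrib]
    exact Finset.sum_congr rfl fun c _ => by ring
  simp only [dW, dvocDot, nodeCur, h1, h2, h3, h4]
  rw [hA, hB]
  ring

/-- `B_nᵀ L_T Z_T⁻¹ ℬᵀ = 0` (proof of Prop. 6: `L_T Z_T⁻¹ = (ρ/(ω₀²ρ²+1))(I_{2M} − ω₀J_M)` by
Assumption 1, and `B_nᵀ Bᵀ = (B B_n)ᵀ = 0`): the cycle component of a steady-state current vanishes,
`(B_nᵀ L_T i^s(u))_c = 0`, first component. [cite: GrossEtAl2019, App. proof of Prop. 6] -/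
theorem cyc₁_iss (hC : E.IsCycle C) (ha : ∀ l, E.a l ≠ 0) (u : DvocState N) (c : Fin M₀) :
    E.cyc₁ C (E.iss u) c = 0 := by
  have key : ∀ l, C c l * E.ind l * E.iss₁ u l
      = E.ρ * E.cκ * (C c l * (E.cκ * E.dV₁ u l + E.sκ * E.dV₂ u l)) := by
    intro l
    have := E.ind_mul_a (ha l)
    unfold iss₁
    linear_combination (C c l * (E.cκ * E.dV₁ u l + E.sκ * E.dV₂ u l)) * this
  simp only [cyc₁, iss]
  rw [Finset.sum_congr rfl fun l _ => key l, ← Finset.mul_sum]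
  suffices h0 : (∑ l, C c l * (E.cκ * E.dV₁ u l + E.sκ * E.dV₂ u l)) = 0 by rw [h0, mul_zero]
  have hl : ∀ l, C c l * (E.cκ * E.dV₁ u l + E.sκ * E.dV₂ u l)
      = ∑ k, C c l * E.inc k l * (E.cκ * u.1 k + E.sκ * u.2 k) := by
    intro l
    rw [dV₁_eq_sum, dV₂_eq_sum, Finset.mul_sum, Finset.mul_sum, ← Finset.sum_add_distrib,
      Finset.mul_sum]
    exact Finset.sum_congr rfl fun k _ => by ring
  rw [Finset.sum_congr rfl fun l _ => hl l, Finset.sum_comm]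
  refine Finset.sum_eq_zero fun k _ => ?_
  rw [← Finset.sum_mul, hC c k, zero_mul]

/-- `(B_nᵀ L_T i^s(u))_c = 0`, second component. [cite: GrossEtAl2019, App. proof of Prop. 6] -/
theorem cyc₂_iss (hC : E.IsCycle C) (ha : ∀ l, E.a l ≠ 0) (u : DvocState N) (c : Fin M₀) :
    E.cyc₂ C (E.iss u) c = 0 := by
  have key : ∀ l, C c l * E.ind l * E.iss₂ u l
      = E.ρ * E.cκ * (C c l * (-E.sκ * E.dV₁ u l + E.cκ * E.dV₂ u l)) := by
    intro l
    have := E.ind_mul_a (ha l)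
    unfold iss₂
    linear_combination (C c l * (-E.sκ * E.dV₁ u l + E.cκ * E.dV₂ u l)) * this
  simp only [cyc₂, iss]
  rw [Finset.sum_congr rfl fun l _ => key l, ← Finset.mul_sum]
  suffices h0 : (∑ l, C c l * (-E.sκ * E.dV₁ u l + E.cκ * E.dV₂ u l)) = 0 by rw [h0, mul_zero]
  have hl : ∀ l, C c l * (-E.sκ * E.dV₁ u l + E.cκ * E.dV₂ u l)
      = ∑ k, C c l * E.inc k l * (-E.sκ * u.1 k + E.cκ * u.2 k) := by
    intro l
    rw [dV₁_eq_sum, dV₂_eq_sum, Finset.mul_sum, Finset.mul_sum, ← Finset.sum_add_distrib,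
      Finset.mul_sum]
    exact Finset.sum_congr rfl fun k _ => by ring
  rw [Finset.sum_congr rfl fun l _ => hl l, Finset.sum_comm]
  refine Finset.sum_eq_zero fun k _ => ?_
  rw [← Finset.sum_mul, hC c k, zero_mul]

/-- **The coupling term of Prop. 6, exactly**: `(∂W/∂y) (−L_T⁻¹Z_T y − Z_T⁻¹ℬᵀ u) = −‖y_o‖² − ‖y_n‖²
− ρ (ℬy)ᵀ 𝒴 u` — the cycle part of `W` does not see the interconnection. (`u` will be `f_v(v,i)`.)
[cite: GrossEtAl2019, Prop. 4 and App. proof of Prop. 6] -/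
theorem dW_blVec_sub_iss (hρ : E.ρ ≠ 0) (hC : E.IsCycle C) (ha : ∀ l, E.a l ≠ 0)
    (y : LineState M) (u : DvocState N) :
    E.dW C y (E.blVec y - E.iss u)
      = -(E.normYoSq y + E.normYnSq C y) - E.ρ * dvocDot (E.nodeCur y) (E.admit u) := by
  rw [E.dW_sub, E.dW_blVec C hρ]
  have hz : (∑ c, (E.cyc₁ C y c * E.cyc₁ C (E.iss u) c + E.cyc₂ C y c * E.cyc₂ C (E.iss u) c)) = 0 :=
    Finset.sum_eq_zero fun c _ => by rw [E.cyc₁_iss C hC ha, E.cyc₂_iss C hC ha]; ring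
  unfold dW admit
  rw [hz]
  ring

end cycle


/-! ## §7 Norms: Cauchy–Schwarz, rotations, the admittance bound `‖𝒴‖ ≤ Υ` -/

/-- Cauchy–Schwarz on `ℝ^{2N}` in split coordinates. [folklore] -/
private theorem cs_pair (p p' q q' : Fin N → ℝ) :
    (∑ k, (p k * q k + p' k * q' k)) ^ 2
      ≤ (∑ k, (p k ^ 2 + p' k ^ 2)) * ∑ k, (q k ^ 2 + q' k ^ 2) := by
  have h := Finset.sum_mul_sq_le_sq_mul_sq (Finset.univ : Finset (Fin N ⊕ Fin N))
    (Sum.elim p p') (Sum.elim q q')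
  simpa only [Fintype.sum_sum_type, Sum.elim_inl, Sum.elim_inr, Finset.sum_add_distrib] using h

/-- `|uᵀ z| ≤ ‖u‖ ‖z‖` with the norms as square roots of `Σ_k ‖·_k‖²`. [folklore] -/
private theorem abs_dvocDot_le (u z : DvocState N) :
    |dvocDot u z| ≤ Real.sqrt (∑ k, dvocNsq u k) * Real.sqrt (∑ k, dvocNsq z k) := by
  have hcs : dvocDot u z ^ 2 ≤ (∑ k, dvocNsq u k) * ∑ k, dvocNsq z k := by
    have := cs_pair u.1 u.2 z.1 z.2
    simpa only [dvocDot, dvocNsq] using this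
  have hu : 0 ≤ ∑ k, dvocNsq u k := Finset.sum_nonneg fun k _ => by unfold dvocNsq; positivity
  have hz : 0 ≤ ∑ k, dvocNsq z k := Finset.sum_nonneg fun k _ => by unfold dvocNsq; positivity
  rw [← Real.sqrt_mul hu, ← Real.sqrt_sq_eq_abs]
  exact Real.sqrt_le_sqrt hcs

/-- Minkowski: `‖p + q‖ ≤ ‖p‖ + ‖q‖` on `ℝ^{2N}`. [folklore] -/
private theorem sqrt_nsq_add_le (p q : DvocState N) :
    Real.sqrt (∑ k, dvocNsq (p + q) k)
      ≤ Real.sqrt (∑ k, dvocNsq p k) + Real.sqrt (∑ k, dvocNsq q k) := by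
  set P := Real.sqrt (∑ k, dvocNsq p k) with hP
  set Q := Real.sqrt (∑ k, dvocNsq q k) with hQ
  have hp0 : 0 ≤ ∑ k, dvocNsq p k := Finset.sum_nonneg fun k _ => by unfold dvocNsq; positivity
  have hq0 : 0 ≤ ∑ k, dvocNsq q k := Finset.sum_nonneg fun k _ => by unfold dvocNsq; positivity
  have hP2 : P ^ 2 = ∑ k, dvocNsq p k := by rw [hP, Real.sq_sqrt hp0]
  have hQ2 : Q ^ 2 = ∑ k, dvocNsq q k := by rw [hQ, Real.sq_sqrt hq0]
  have hP0 : 0 ≤ P := Real.sqrt_nonneg _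
  have hQ0 : 0 ≤ Q := Real.sqrt_nonneg _
  have hdot : dvocDot p q ≤ P * Q := (le_abs_self _).trans (abs_dvocDot_le p q)
  have hexp : (∑ k, dvocNsq (p + q) k) = (∑ k, dvocNsq p k) + 2 * dvocDot p q + ∑ k, dvocNsq q k := by
    simp only [dvocNsq, dvocDot, Prod.fst_add, Prod.snd_add, Pi.add_apply, Finset.mul_sum,
      ← Finset.sum_add_distrib]
    exact Finset.sum_congr rfl fun k _ => by ring
  have hle : (∑ k, dvocNsq (p + q) k) ≤ (P + Q) ^ 2 := by rw [hexp]; nlinarith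
  calc Real.sqrt (∑ k, dvocNsq (p + q) k) ≤ Real.sqrt ((P + Q) ^ 2) := Real.sqrt_le_sqrt hle
    _ = P + Q := Real.sqrt_sq (by positivity)

/-- `‖c • p‖ = c ‖p‖` for `c ≥ 0`, in coordinates. [folklore] -/
private theorem sqrt_nsq_smul {c : ℝ} (hc : 0 ≤ c) (p z : DvocState N)
    (hz : ∀ k, z.1 k = c * p.1 k ∧ z.2 k = c * p.2 k) :
    Real.sqrt (∑ k, dvocNsq z k) = c * Real.sqrt (∑ k, dvocNsq p k) := by
  have : (∑ k, dvocNsq z k) = c ^ 2 * ∑ k, dvocNsq p k := by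
    rw [Finset.mul_sum]
    exact Finset.sum_congr rfl fun k _ => by simp only [dvocNsq, (hz k).1, (hz k).2]; ring
  rw [this, Real.sqrt_mul' _ (Finset.sum_nonneg fun k _ => by unfold dvocNsq; positivity),
    Real.sqrt_sq hc]

/-- `R(κ) ℬ y ∈ ℝ^{2N}`, the coupling vector of (15a)/(43) (`f_v(0, y) = −η R(κ) ℬ y`).
[cite: GrossEtAl2019, eq. (15a), (43)] -/
def couple (y : LineState M) : DvocState N :=
  (fun k => E.cκ * E.nodeCur₁ y k - E.sκ * E.nodeCur₂ y k,
   fun k => E.sκ * E.nodeCur₁ y k + E.cκ * E.nodeCur₂ y k)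

/-- Rotations preserve the norm: `‖R(κ) ℬ y‖² = ‖y_o‖²` componentwise. [cite: GrossEtAl2019, §II (Notation)] -/
theorem nsq_couple (y : LineState M) (k : Fin N) : dvocNsq (E.couple y) k = dvocNsq (E.nodeCur y) k := by
  have h := E.cκ_sq_add_sκ_sq
  simp only [dvocNsq, couple, nodeCur]
  linear_combination (E.nodeCur₁ y k ^ 2 + E.nodeCur₂ y k ^ 2) * h

/-- `‖R(κ) ℬ y‖ = ‖y_o‖` (so `‖f_v(0, y)‖ = η‖y_o‖`). [cite: GrossEtAl2019, App. proof of Prop. 6] -/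
theorem sum_nsq_couple (y : LineState M) : (∑ k, dvocNsq (E.couple y) k) = E.normYoSq y :=
  Finset.sum_congr rfl fun k _ => E.nsq_couple y k

/-- (43) in vector form: `f_v(v, i) = f(v) − η R(κ) ℬ (i − i^s(v))`. [cite: GrossEtAl2019, eq. (43)] -/
theorem fvVec_eq (h : E.Consistent W) (v : DvocState N) (i : LineState M) :
    E.fvVec W v i = W.field v - W.η • E.couple (E.dev v i) := by
  refine Prod.ext (funext fun k => ?_) (funext fun k => ?_)
  · simp only [fvVec, E.fv₁_eq W h, Prod.fst_sub, Prod.smul_fst, Pi.sub_apply, Pi.smul_apply,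
      smul_eq_mul, DvocReduced.field, couple]
  · simp only [fvVec, E.fv₂_eq W h, Prod.snd_sub, Prod.smul_snd, Pi.sub_apply, Pi.smul_apply,
      smul_eq_mul, DvocReduced.field, couple]

/-- The operator-norm step `‖𝒴 u‖ ≤ ‖𝒴‖ ‖u‖` as an instance property with a constant `Υ ≥ ‖𝒴‖`:
`‖𝒴 u‖² ≤ Υ² ‖u‖²` for all `u` (one PSD certificate `Υ² I − 𝒴ᵀ𝒴 ⪰ 0` for a concrete network; print
uses `‖𝒴‖` itself, `β₂ := ρ‖𝒴‖`, `γ := ηρ‖𝒴‖`). [cite: GrossEtAl2019, Prop. 6] -/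
def AdmittanceBound (Υ : ℝ) : Prop :=
  ∀ u : DvocState N, (∑ k, dvocNsq (E.admit u) k) ≤ Υ ^ 2 * ∑ k, dvocNsq u k

/-- `|(ℬy)ᵀ 𝒴 u| ≤ ‖y_o‖ Υ ‖u‖` (`Υ ≥ 0`). [cite: GrossEtAl2019, App. proof of Prop. 6] -/
theorem abs_dot_admit_le {Υ : ℝ} (hΥ : 0 ≤ Υ) (hY : E.AdmittanceBound Υ) (y : LineState M)
    (u : DvocState N) :
    |dvocDot (E.nodeCur y) (E.admit u)|
      ≤ Real.sqrt (E.normYoSq y) * (Υ * Real.sqrt (∑ k, dvocNsq u k)) := by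
  have h1 := abs_dvocDot_le (E.nodeCur y) (E.admit u)
  have h2 : Real.sqrt (∑ k, dvocNsq (E.admit u) k) ≤ Υ * Real.sqrt (∑ k, dvocNsq u k) := by
    have hu : 0 ≤ ∑ k, dvocNsq u k := Finset.sum_nonneg fun k _ => by unfold dvocNsq; positivity
    calc Real.sqrt (∑ k, dvocNsq (E.admit u) k)
        ≤ Real.sqrt (Υ ^ 2 * ∑ k, dvocNsq u k) := Real.sqrt_le_sqrt (hY u)
      _ = Υ * Real.sqrt (∑ k, dvocNsq u k) := by rw [Real.sqrt_mul' _ hu, Real.sqrt_sq hΥ]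
  unfold normYoSq
  exact h1.trans (mul_le_mul_of_nonneg_left h2 (Real.sqrt_nonneg _))

/-- `𝒴` is linear (pointwise form). [folklore] -/
private theorem admit_lin (u w z : DvocState N) (a b : ℝ)
    (hz : ∀ k, z.1 k = a * u.1 k + b * w.1 k ∧ z.2 k = a * u.2 k + b * w.2 k) (k : Fin N) :
    (E.admit z).1 k = a * (E.admit u).1 k + b * (E.admit w).1 k ∧
      (E.admit z).2 k = a * (E.admit u).2 k + b * (E.admit w).2 k := by
  have hd : ∀ l, E.dV₁ z l = a * E.dV₁ u l + b * E.dV₁ w l ∧ E.dV₂ z l = a * E.dV₂ u l + b * E.dV₂ w l :=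
    fun l => by
      simp only [dV₁, dV₂, (hz (E.src l)).1, (hz (E.dst l)).1, (hz (E.src l)).2, (hz (E.dst l)).2]
      constructor <;> ring
  constructor
  · simp only [admit, nodeCur, nodeCur₁, iss, iss₁, Finset.mul_sum, ← Finset.sum_add_distrib]
    exact Finset.sum_congr rfl fun l _ => by rw [(hd l).1, (hd l).2]; ring
  · simp only [admit, nodeCur, nodeCur₂, iss, iss₂, Finset.mul_sum, ← Finset.sum_add_distrib]
    exact Finset.sum_congr rfl fun l _ => by rw [(hd l).1, (hd l).2]; ring

/-- `‖f(v)‖ ≤ ψ(v)`: the reduced field is bounded by the comparison function (21), given the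
phase-error bound `‖e_θ(v)‖ ≤ κ₀‖v‖_S` and `η, α, κ₀ ≥ 0`. [cite: GrossEtAl2019, App. proof of Prop. 6
(«‖f_v(v, i^s(v))‖ ≤ ψ(v)»)] -/
theorem sqrt_nsq_field_le (hη : 0 ≤ W.η) (hα : 0 ≤ W.α) (hΛ : W.Lam ≠ 0) {κ₀ : ℝ} (hκ₀ : 0 ≤ κ₀)
    (hK : W.PhaseErrorBound κ₀) (v : DvocState N) :
    Real.sqrt (∑ k, dvocNsq (W.field v) k) ≤ W.psi κ₀ v := by
  have hg : W.field v = W.η • W.gVec v := by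
    refine Prod.ext (funext fun k => ?_) (funext fun k => ?_) <;>
      simp [DvocReduced.field, DvocReduced.gVec]
  have hsplit : W.gVec v = W.eθ v + W.α • W.PhiVec v := by
    refine Prod.ext (funext fun k => ?_) (funext fun k => ?_) <;>
      simp [DvocReduced.gVec, DvocReduced.g₁, DvocReduced.g₂, DvocReduced.eθ, DvocReduced.PhiVec] <;>
      ring
  have h1 : Real.sqrt (∑ k, dvocNsq (W.field v) k) = W.η * Real.sqrt (∑ k, dvocNsq (W.gVec v) k) :=
    sqrt_nsq_smul hη (W.gVec v) (W.field v) fun k => by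
      simp [hg]
  have h2 : Real.sqrt (∑ k, dvocNsq (W.α • W.PhiVec v) k)
      = W.α * Real.sqrt (∑ k, dvocNsq (W.PhiVec v) k) :=
    sqrt_nsq_smul hα (W.PhiVec v) _ fun k => by simp
  have h3 : Real.sqrt (∑ k, dvocNsq (W.eθ v) k) ≤ κ₀ * Real.sqrt (W.normS2 v) := by
    have hk := hK v
    have he : (∑ k, dvocNsq (W.eθ v) k) = ∑ k, (W.eθ₁ v k ^ 2 + W.eθ₂ v k ^ 2) := by
      simp [dvocNsq, DvocReduced.eθ]
    rw [he]
    calc Real.sqrt (∑ k, (W.eθ₁ v k ^ 2 + W.eθ₂ v k ^ 2))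
        ≤ Real.sqrt (κ₀ ^ 2 * W.normS2 v) := Real.sqrt_le_sqrt hk
      _ = κ₀ * Real.sqrt (W.normS2 v) := by
          rw [Real.sqrt_mul' _ (W.normS2_nonneg hΛ v), Real.sqrt_sq hκ₀]
  have h4 : (∑ k, dvocNsq (W.PhiVec v) k) = ∑ k, W.Phi v k ^ 2 * dvocNsq v k := by
    refine Finset.sum_congr rfl fun k _ => ?_
    simp only [dvocNsq, DvocReduced.PhiVec]; ring
  have hm := sqrt_nsq_add_le (W.eθ v) (W.α • W.PhiVec v)
  rw [← hsplit, h2, h4] at hm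
  rw [h1]
  unfold DvocReduced.psi
  exact mul_le_mul_of_nonneg_left (hm.trans (by linarith)) hη


/-! ## §8 Propositions 5 and 6: the two interconnection bounds -/

/-- The directional derivative of the reduced Lyapunov function (19) at `v` along `u`:
`(∂V/∂v) u = vᵀ P_S u − 2ηαα₁ Σ_k Φ_k(v_k) v_kᵀ u_k` (so that `(∂V/∂v) f(v) = (26)`).
[cite: GrossEtAl2019, eq. (19), (26)] -/
def dV (α₁ : ℝ) (v u : DvocState N) : ℝ :=
  W.qS v u - 2 * W.η * W.α * α₁ * ∑ k, W.Phi v k * (v.1 k * u.1 k + v.2 k * u.2 k)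

/-- `(∂V/∂v) f(v)` is the printed expression (26) (`DvocReduced.Vdot`). [cite: GrossEtAl2019, eq. (26)] -/
theorem dV_field (α₁ : ℝ) (v : DvocState N) : dV W α₁ v (W.field v) = W.Vdot α₁ v := by
  have hd : dvocDot v (W.field v) = W.η * dvocDot v (W.gVec v) := by
    simp only [dvocDot, DvocReduced.field, DvocReduced.gVec, Finset.mul_sum]
    exact Finset.sum_congr rfl fun k _ => by ring
  have hs1 : W.sig₁ (W.field v) = W.η * W.sig₁ (W.gVec v) := by
    simp only [DvocReduced.sig₁, DvocReduced.field, DvocReduced.gVec, Finset.mul_sum]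
    exact Finset.sum_congr rfl fun k _ => by ring
  have hs2 : W.sig₂ (W.field v) = W.η * W.sig₂ (W.gVec v) := by
    simp only [DvocReduced.sig₂, DvocReduced.field, DvocReduced.gVec, Finset.mul_sum]
    exact Finset.sum_congr rfl fun k _ => by ring
  have hp : (∑ k, W.Phi v k * (v.1 k * (W.field v).1 k + v.2 k * (W.field v).2 k))
      = W.η * ∑ k, W.Phi v k * (v.1 k * W.g₁ v k + v.2 k * W.g₂ v k) := by
    simp only [DvocReduced.field, Finset.mul_sum]
    exact Finset.sum_congr rfl fun k _ => by ring
  simp only [dV, DvocReduced.Vdot, DvocReduced.qS, hd, hs1, hs2, hp]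
  ring

/-- `(∂V/∂v)` is linear in the direction (pointwise form). [folklore] -/
private theorem dV_lin (α₁ : ℝ) (v u w z : DvocState N) (a b : ℝ)
    (hz : ∀ k, z.1 k = a * u.1 k + b * w.1 k ∧ z.2 k = a * u.2 k + b * w.2 k) :
    dV W α₁ v z = a * dV W α₁ v u + b * dV W α₁ v w := by
  have hd : dvocDot v z = a * dvocDot v u + b * dvocDot v w := by
    simp only [dvocDot, Finset.mul_sum, ← Finset.sum_add_distrib]
    exact Finset.sum_congr rfl fun k _ => by rw [(hz k).1, (hz k).2]; ring
  have hs1 : W.sig₁ z = a * W.sig₁ u + b * W.sig₁ w := by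
    simp only [DvocReduced.sig₁, Finset.mul_sum, ← Finset.sum_add_distrib]
    exact Finset.sum_congr rfl fun k _ => by rw [(hz k).1, (hz k).2]; ring
  have hs2 : W.sig₂ z = a * W.sig₂ u + b * W.sig₂ w := by
    simp only [DvocReduced.sig₂, Finset.mul_sum, ← Finset.sum_add_distrib]
    exact Finset.sum_congr rfl fun k _ => by rw [(hz k).1, (hz k).2]; ring
  have hp : (∑ k, W.Phi v k * (v.1 k * z.1 k + v.2 k * z.2 k))
      = a * (∑ k, W.Phi v k * (v.1 k * u.1 k + v.2 k * u.2 k))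
        + b * ∑ k, W.Phi v k * (v.1 k * w.1 k + v.2 k * w.2 k) := by
    simp only [Finset.mul_sum, ← Finset.sum_add_distrib]
    exact Finset.sum_congr rfl fun k _ => by rw [(hz k).1, (hz k).2]; ring
  simp only [dV, DvocReduced.qS, hd, hs1, hs2, hp]
  ring

/-- Splitting `(∂V/∂v) f_v(v,i)` as in the proof of Prop. 7:
`(∂V/∂v) f_v(v, i) = (∂V/∂v) f(v) + (∂V/∂v)[f_v(v, y + i^s(v)) − f_v(v, i^s(v))]`
`= (26) − η (∂V/∂v)(R(κ) ℬ y)`. [cite: GrossEtAl2019, proof of Prop. 7] -/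
theorem dV_fvVec (h : E.Consistent W) (α₁ : ℝ) (v : DvocState N) (i : LineState M) :
    dV W α₁ v (E.fvVec W v i) = W.Vdot α₁ v - W.η * dV W α₁ v (E.couple (E.dev v i)) := by
  have hz := E.fvVec_eq W h v i
  have := dV_lin W α₁ v (W.field v) (E.couple (E.dev v i)) (E.fvVec W v i) 1 (-W.η) fun k => by
    rw [hz]; simp; constructor <;> ring
  rw [this, dV_field]
  ring

/-- **Proposition 5** [cite: GrossEtAl2019, Prop. 5]: with `β₁ := ‖𝒦 − 𝓛‖⁻¹` (here `κ₀⁻¹` for the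
bound `κ₀ ≥ ‖𝒦 − 𝓛‖`, `c ≤ κ₀` as print derives from (23)), for all `v` and `y`,
`(∂V/∂v)[f_v(v, y + i^s(v)) − f_v(v, i^s(v))] ≤ β₁ ψ(v) ‖y_o‖` — in the form
`η |(∂V/∂v)(R(κ)ℬy)| ≤ κ₀⁻¹ ψ(v) ‖y_o‖` (both signs, the cross term being `−η(∂V/∂v)(R(κ)ℬy)`).
Printed chain: `≤ (η‖v‖_S + 2αα₁η²‖Φ(v)v‖)‖y_o‖` (Cauchy–Schwarz twice), then `2α₁η ≤ β₁`. -/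
theorem prop5 [NeZero N] (hη : 0 ≤ W.η) (hα : 0 ≤ W.α) (hv : ∀ k, 0 < W.vref k)
    {c κ₀ : ℝ} (hc : 0 ≤ c) (hκ₀ : 0 < κ₀) (hcκ : c ≤ κ₀) (v : DvocState N) (y : LineState M) :
    W.η * |dV W (W.alpha1 c κ₀) v (E.couple y)|
      ≤ 1 / κ₀ * W.psi κ₀ v * Real.sqrt (E.normYoSq y) := by
  have hΛ : W.Lam ≠ 0 := (W.Lam_pos hv).ne'
  set α₁ := W.alpha1 c κ₀ with hα₁
  set a := Real.sqrt (W.normS2 v) with ha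
  set B := ∑ k, W.Phi v k ^ 2 * dvocNsq v k with hB
  set b := Real.sqrt B with hb
  set Yo := Real.sqrt (E.normYoSq y) with hYo
  have ha0 : 0 ≤ a := Real.sqrt_nonneg _
  have hb0 : 0 ≤ b := Real.sqrt_nonneg _
  have hYo0 : 0 ≤ Yo := Real.sqrt_nonneg _
  have hB0 : 0 ≤ B := Finset.sum_nonneg fun k _ => by unfold dvocNsq; positivity
  -- first Cauchy–Schwarz: `|vᵀ P_S (R(κ)ℬy)| ≤ ‖v‖_S ‖y_o‖`
  have h1 : |W.qS v (E.couple y)| ≤ a * Yo := by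
    rw [W.qS_eq_dot_projS]
    have := abs_dvocDot_le (W.projS v) (E.couple y)
    rwa [← W.normS2_eq_sum_nsq_projS hΛ, E.sum_nsq_couple] at this
  -- second Cauchy–Schwarz: `|Σ Φ_k v_kᵀ (R(κ)ℬy)_k| ≤ ‖Φ(v)v‖ ‖y_o‖`
  have h2 : |∑ k, W.Phi v k * (v.1 k * (E.couple y).1 k + v.2 k * (E.couple y).2 k)| ≤ b * Yo := by
    have cs := cs_pair (fun k => W.Phi v k * v.1 k) (fun k => W.Phi v k * v.2 k)
      (E.couple y).1 (E.couple y).2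
    have hE : (∑ k, (W.Phi v k * v.1 k * (E.couple y).1 k + W.Phi v k * v.2 k * (E.couple y).2 k))
        = ∑ k, W.Phi v k * (v.1 k * (E.couple y).1 k + v.2 k * (E.couple y).2 k) :=
      Finset.sum_congr rfl fun k _ => by ring
    have hB' : (∑ k, ((W.Phi v k * v.1 k) ^ 2 + (W.Phi v k * v.2 k) ^ 2)) = B := by
      rw [hB]; exact Finset.sum_congr rfl fun k _ => by simp only [dvocNsq]; ring
    have hY' : (∑ k, ((E.couple y).1 k ^ 2 + (E.couple y).2 k ^ 2)) = E.normYoSq y := by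
      rw [← E.sum_nsq_couple]; rfl
    rw [hE, hB', hY'] at cs
    have hsq : (∑ k, W.Phi v k * (v.1 k * (E.couple y).1 k + v.2 k * (E.couple y).2 k)) ^ 2
        ≤ (b * Yo) ^ 2 := by
      rw [mul_pow, hb, hYo, Real.sq_sqrt hB0, Real.sq_sqrt (E.normYoSq_nonneg y)]; exact cs
    exact abs_le_of_sq_le_sq' hsq (by positivity) |> fun h => abs_le.2 ⟨h.1, h.2⟩
  -- assemble `|dV| ≤ a Yo + 2ηαα₁ b Yo`
  have hα₁0 : 0 ≤ α₁ := by rw [hα₁]; unfold DvocReduced.alpha1; positivity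
  have hcoef : 0 ≤ 2 * W.η * W.α * α₁ := by positivity
  have h3 : |dV W α₁ v (E.couple y)| ≤ a * Yo + 2 * W.η * W.α * α₁ * (b * Yo) := by
    unfold dV
    have := abs_sub (W.qS v (E.couple y))
      (2 * W.η * W.α * α₁ * ∑ k, W.Phi v k * (v.1 k * (E.couple y).1 k + v.2 k * (E.couple y).2 k))
    refine this.trans ?_
    rw [abs_mul, abs_of_nonneg hcoef]
    exact add_le_add h1 (mul_le_mul_of_nonneg_left h2 hcoef)
  -- the gain comparison `2α₁η ≤ β₁ = κ₀⁻¹` from `c ≤ κ₀`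
  have hgain : W.η * (2 * W.η * W.α * α₁) ≤ W.η * (W.α / κ₀) := by
    refine mul_le_mul_of_nonneg_left ?_ hη
    rw [hα₁]; unfold DvocReduced.alpha1
    by_cases hη0 : W.η = 0
    · simp [hη0]; positivity
    · have hex : W.α / κ₀ - 2 * W.η * W.α * (c / (5 * W.η * κ₀ ^ 2))
          = W.α * (5 * κ₀ - 2 * c) / (5 * κ₀ ^ 2) := by
        field_simp
      have hnum : 0 ≤ W.α * (5 * κ₀ - 2 * c) / (5 * κ₀ ^ 2) := by
        have : 0 ≤ 5 * κ₀ - 2 * c := by linarith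
        positivity
      linarith
  have hpsi : W.psi κ₀ v = W.η * (κ₀ * a + W.α * b) := by simp only [DvocReduced.psi, ha, hb, hB]
  rw [hpsi]
  calc W.η * |dV W α₁ v (E.couple y)|
      ≤ W.η * (a * Yo + 2 * W.η * W.α * α₁ * (b * Yo)) := mul_le_mul_of_nonneg_left h3 hη
    _ = W.η * a * Yo + W.η * (2 * W.η * W.α * α₁) * (b * Yo) := by ring
    _ ≤ W.η * a * Yo + W.η * (W.α / κ₀) * (b * Yo) := by
        have := mul_le_mul_of_nonneg_right hgain (mul_nonneg hb0 hYo0); linarith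
    _ = 1 / κ₀ * (W.η * (κ₀ * a + W.α * b)) * Yo := by field_simp

/-- **Proposition 6** [cite: GrossEtAl2019, Prop. 6]: with `β₂ := ρ‖𝒴‖`, `γ := ηρ‖𝒴‖` (here with
the bound `Υ ≥ ‖𝒴‖`), for all `v` and `y = i − i^s(v)`,
`−(∂W/∂y)(∂i^s/∂v) f_v(v, y + i^s(v)) ≤ β₂ ψ(v) ‖y_o‖ + γ ‖y_o‖²`, in the form
`ρ |(ℬy)ᵀ 𝒴 f_v(v, i)| ≤ ρΥ ψ(v)‖y_o‖ + ηρΥ ‖y_o‖²` (the cycle part contributes nothing, §6).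
Printed chain: `‖f_v(v, i^s(v))‖ ≤ ψ(v)`, `‖f_v(0, y)‖ = η‖y_o‖`. -/
theorem prop6 [NeZero N] (h : E.Consistent W) (hρ : 0 ≤ E.ρ) (hη : 0 ≤ W.η) (hα : 0 ≤ W.α)
    (hv : ∀ k, 0 < W.vref k) {κ₀ Υ : ℝ} (hκ₀ : 0 ≤ κ₀) (hΥ : 0 ≤ Υ)
    (hK : W.PhaseErrorBound κ₀) (hY : E.AdmittanceBound Υ) (v : DvocState N) (i : LineState M) :
    E.ρ * |dvocDot (E.nodeCur (E.dev v i)) (E.admit (E.fvVec W v i))|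
      ≤ E.ρ * Υ * W.psi κ₀ v * Real.sqrt (E.normYoSq (E.dev v i))
        + W.η * E.ρ * Υ * E.normYoSq (E.dev v i) := by
  have hΛ : W.Lam ≠ 0 := (W.Lam_pos hv).ne'
  set y := E.dev v i with hy
  set Yo := Real.sqrt (E.normYoSq y) with hYo
  have hYo0 : 0 ≤ Yo := Real.sqrt_nonneg _
  have hYo2 : Yo ^ 2 = E.normYoSq y := by rw [hYo, Real.sq_sqrt (E.normYoSq_nonneg y)]
  -- `𝒴 f_v(v,i) = 𝒴 f(v) − η 𝒴 R(κ)ℬy`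
  have hz := E.fvVec_eq W h v i
  have hlin := E.admit_lin (W.field v) (E.couple y) (E.fvVec W v i) 1 (-W.η) fun k => by
    rw [hz]; simp [hy]; constructor <;> ring
  have hsplit : dvocDot (E.nodeCur y) (E.admit (E.fvVec W v i))
      = dvocDot (E.nodeCur y) (E.admit (W.field v))
        - W.η * dvocDot (E.nodeCur y) (E.admit (E.couple y)) := by
    simp only [dvocDot, Finset.mul_sum, ← Finset.sum_sub_distrib]
    exact Finset.sum_congr rfl fun k _ => by rw [(hlin k).1, (hlin k).2]; ring
  have h1 : |dvocDot (E.nodeCur y) (E.admit (W.field v))| ≤ Yo * (Υ * W.psi κ₀ v) := by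
    refine (E.abs_dot_admit_le hΥ hY y (W.field v)).trans ?_
    exact mul_le_mul_of_nonneg_left
      (mul_le_mul_of_nonneg_left (sqrt_nsq_field_le W hη hα hΛ hκ₀ hK v) hΥ) hYo0
  have h2 : |dvocDot (E.nodeCur y) (E.admit (E.couple y))| ≤ Yo * (Υ * Yo) := by
    have := E.abs_dot_admit_le hΥ hY y (E.couple y)
    rwa [E.sum_nsq_couple] at this
  have h3 : |dvocDot (E.nodeCur y) (E.admit (E.fvVec W v i))|
      ≤ Yo * (Υ * W.psi κ₀ v) + W.η * (Yo * (Υ * Yo)) := by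
    rw [hsplit]
    refine (abs_sub _ _).trans ?_
    rw [abs_mul, abs_of_nonneg hη]
    exact add_le_add h1 (mul_le_mul_of_nonneg_left h2 hη)
  calc E.ρ * |dvocDot (E.nodeCur y) (E.admit (E.fvVec W v i))|
      ≤ E.ρ * (Yo * (Υ * W.psi κ₀ v) + W.η * (Yo * (Υ * Yo))) := mul_le_mul_of_nonneg_left h3 hρ
    _ = E.ρ * Υ * W.psi κ₀ v * Yo + W.η * E.ρ * Υ * Yo ^ 2 := by ring
    _ = E.ρ * Υ * W.psi κ₀ v * Yo + W.η * E.ρ * Υ * E.normYoSq y := by rw [hYo2]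


/-! ## §9 The composite Lyapunov function `ν` (32) and its derivative along solutions of (15) -/

section composite

variable {M₀ : ℕ} (C : Fin M₀ → Fin M → ℝ)

/-- **(32)** `ν(x) := d W(i − i^s(v)) + (1 − d) V(v)` for `x = (v, i)`, with the weights `d` and `α₁`
kept as parameters (print: `d := β₁/(β₁ + β₂)`, `α₁ := c/(5η‖𝒦 − 𝓛‖²)`). [cite: GrossEtAl2019, eq. (32)] -/
def nu (d α₁ : ℝ) (x : DvocState N × LineState M) : ℝ :=
  d * E.Wfun C (E.dev x.1 x.2) + (1 - d) * W.V α₁ x.1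

/-- The derivative of `ν` along (15), as the printed decomposition (proof of Prop. 7):
`d[(∂W/∂y) f_i(v, y + i^s(v)) − (∂W/∂y)(∂i^s/∂v) f_v(v, y + i^s(v))]`
`+ (1 − d)[(∂V/∂v) f_v(v, i^s(v)) + (∂V/∂v)(f_v(v, y + i^s(v)) − f_v(v, i^s(v)))]`, with the two
`W`-terms already evaluated (§6): `−‖y_o‖² − ‖y_n‖² − ρ (ℬy)ᵀ 𝒴 f_v(v,i)`.
[cite: GrossEtAl2019, proof of Prop. 7] -/
def nuDot (d α₁ : ℝ) (x : DvocState N × LineState M) : ℝ :=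
  d * (-(E.normYoSq (E.dev x.1 x.2) + E.normYnSq C (E.dev x.1 x.2))
        - E.ρ * dvocDot (E.nodeCur (E.dev x.1 x.2)) (E.admit (E.fvVec W x.1 x.2)))
    + (1 - d) * (W.Vdot α₁ x.1 - W.η * dV W α₁ x.1 (E.couple (E.dev x.1 x.2)))

/-- Chain rule for the reduced Lyapunov function (19) along an ARBITRARY differentiable voltage
curve: derivative `(∂V/∂v) u` (`dV`) — the tree's `hasDerivWithinAt_V` is the case `u = f(v)`.
[cite: GrossEtAl2019, eq. (19), (26)] -/
theorem hasDerivWithinAt_V_dir (α₁ : ℝ) {γ : ℝ → DvocState N} {u : DvocState N} {s : Set ℝ} {t : ℝ}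
    (h1 : ∀ k, HasDerivWithinAt (fun τ => (γ τ).1 k) (u.1 k) s t)
    (h2 : ∀ k, HasDerivWithinAt (fun τ => (γ τ).2 k) (u.2 k) s t) :
    HasDerivWithinAt (fun τ => W.V α₁ (γ τ)) (dV W α₁ (γ t) u) s t := by
  set f1 : Fin N → ℝ := fun k => u.1 k with hf1
  set f2 : Fin N → ℝ := fun k => u.2 k with hf2
  have h1' : ∀ k, HasDerivWithinAt (fun τ => (γ τ).1 k) (f1 k) s t := h1
  have h2' : ∀ k, HasDerivWithinAt (fun τ => (γ τ).2 k) (f2 k) s t := h2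
  -- squared magnitudes
  have hn : ∀ k, HasDerivWithinAt (fun τ => dvocNsq (γ τ) k)
      (2 * ((γ t).1 k * f1 k + (γ t).2 k * f2 k)) s t := by
    intro k
    have := ((h1' k).mul (h1' k)).add ((h2' k).mul (h2' k))
    have hf : (fun τ => dvocNsq (γ τ) k)
        = fun τ => (γ τ).1 k * (γ τ).1 k + (γ τ).2 k * (γ τ).2 k := by
      funext τ; simp only [dvocNsq]; ring
    rw [hf]
    refine this.congr_deriv ?_
    ring
  have hdot : HasDerivWithinAt (fun τ => dvocDot (γ τ) (γ τ))
      (∑ k, 2 * ((γ t).1 k * f1 k + (γ t).2 k * f2 k)) s t := by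
    have := HasDerivWithinAt.fun_sum (u := Finset.univ) fun k _ => hn k
    have hf : (fun τ => dvocDot (γ τ) (γ τ)) = fun τ => ∑ k, dvocNsq (γ τ) k := by
      funext τ; simp only [dvocDot, dvocNsq]; exact Finset.sum_congr rfl fun k _ => by ring
    rw [hf]
    exact this
  have hs1 : HasDerivWithinAt (fun τ => W.sig₁ (γ τ))
      (∑ k, W.vref k * (cos (W.θ k) * f1 k + sin (W.θ k) * f2 k)) s t := by
    have := HasDerivWithinAt.fun_sum (u := Finset.univ) fun k _ =>
      (((h1' k).const_mul (cos (W.θ k))).add ((h2' k).const_mul (sin (W.θ k)))).const_mul (W.vref k)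
    have hf : (fun τ => W.sig₁ (γ τ))
        = fun τ => ∑ k, W.vref k * (cos (W.θ k) * (γ τ).1 k + sin (W.θ k) * (γ τ).2 k) := by
      funext τ; simp only [DvocReduced.sig₁]
    rw [hf]
    exact this
  have hs2 : HasDerivWithinAt (fun τ => W.sig₂ (γ τ))
      (∑ k, W.vref k * (-sin (W.θ k) * f1 k + cos (W.θ k) * f2 k)) s t := by
    have := HasDerivWithinAt.fun_sum (u := Finset.univ) fun k _ =>
      (((h1' k).const_mul (-sin (W.θ k))).add ((h2' k).const_mul (cos (W.θ k)))).const_mul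
        (W.vref k)
    have hf : (fun τ => W.sig₂ (γ τ))
        = fun τ => ∑ k, W.vref k * (-sin (W.θ k) * (γ τ).1 k + cos (W.θ k) * (γ τ).2 k) := by
      funext τ; simp only [DvocReduced.sig₂]
    rw [hf]
    exact this
  have hp : ∀ k, HasDerivWithinAt (fun τ => (W.vref k ^ 2 - dvocNsq (γ τ) k) ^ 2 / W.vref k ^ 2)
      (2 * (W.vref k ^ 2 - dvocNsq (γ t) k) *
        (-(2 * ((γ t).1 k * f1 k + (γ t).2 k * f2 k))) / W.vref k ^ 2) s t := by
    intro k
    have hc : HasDerivWithinAt (fun τ => W.vref k ^ 2 - dvocNsq (γ τ) k)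
        (-(2 * ((γ t).1 k * f1 k + (γ t).2 k * f2 k))) s t := by
      simpa using (hn k).const_sub (W.vref k ^ 2)
    have := (hc.pow 2).div_const (W.vref k ^ 2)
    refine this.congr_deriv ?_
    simp only [Nat.cast_ofNat]
    ring
  have hpen : HasDerivWithinAt
      (fun τ => ∑ k, (W.vref k ^ 2 - dvocNsq (γ τ) k) ^ 2 / W.vref k ^ 2)
      (∑ k, 2 * (W.vref k ^ 2 - dvocNsq (γ t) k) *
        (-(2 * ((γ t).1 k * f1 k + (γ t).2 k * f2 k))) / W.vref k ^ 2) s t :=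
    HasDerivWithinAt.fun_sum (u := Finset.univ) fun k _ => hp k
  have hq := (hdot.sub (((hs1.mul hs1).add (hs2.mul hs2)).div_const W.Lam)).const_mul (1 / 2)
  have hV := hq.add (hpen.const_mul (1 / 2 * W.η * W.α * α₁))
  have hf : (fun τ => W.V α₁ (γ τ)) = fun τ =>
      1 / 2 * (dvocDot (γ τ) (γ τ)
          - (W.sig₁ (γ τ) * W.sig₁ (γ τ) + W.sig₂ (γ τ) * W.sig₂ (γ τ)) / W.Lam)
        + 1 / 2 * W.η * W.α * α₁ * ∑ k, (W.vref k ^ 2 - dvocNsq (γ τ) k) ^ 2 / W.vref k ^ 2 := by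
    funext τ; simp only [DvocReduced.V, DvocReduced.normS2, DvocReduced.qS]
  rw [hf]
  refine hV.congr_deriv ?_
  have e1 : (∑ k, 2 * ((γ t).1 k * f1 k + (γ t).2 k * f2 k)) = 2 * dvocDot (γ t) u := by
    simp only [dvocDot, hf1, hf2, Finset.mul_sum]
  have e2 : (∑ k, W.vref k * (cos (W.θ k) * f1 k + sin (W.θ k) * f2 k)) = W.sig₁ u := by
    simp only [DvocReduced.sig₁, hf1, hf2]
  have e3 : (∑ k, W.vref k * (-sin (W.θ k) * f1 k + cos (W.θ k) * f2 k)) = W.sig₂ u := by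
    simp only [DvocReduced.sig₂, hf1, hf2]
  have e4 : (∑ k, 2 * (W.vref k ^ 2 - dvocNsq (γ t) k) *
        (-(2 * ((γ t).1 k * f1 k + (γ t).2 k * f2 k))) / W.vref k ^ 2)
      = -4 * ∑ k, W.Phi (γ t) k * ((γ t).1 k * u.1 k + (γ t).2 k * u.2 k) := by
    simp only [DvocReduced.Phi, hf1, hf2, Finset.mul_sum]
    exact Finset.sum_congr rfl fun k _ => by ring
  rw [e1, e2, e3, e4]
  simp only [dV, DvocReduced.qS]
  ring

/-- Chain rule for `W` (31) along an arbitrary differentiable deviation curve: derivative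
`(∂W/∂y) z` (`dW`). [cite: GrossEtAl2019, eq. (31)] -/
theorem hasDerivWithinAt_W_dir {δ : ℝ → LineState M} {z : LineState M} {s : Set ℝ} {t : ℝ}
    (h1 : ∀ l, HasDerivWithinAt (fun τ => (δ τ).1 l) (z.1 l) s t)
    (h2 : ∀ l, HasDerivWithinAt (fun τ => (δ τ).2 l) (z.2 l) s t) :
    HasDerivWithinAt (fun τ => E.Wfun C (δ τ)) (E.dW C (δ t) z) s t := by
  -- node currents
  have hc1 : ∀ k, HasDerivWithinAt (fun τ => E.nodeCur₁ (δ τ) k) (E.nodeCur₁ z k) s t := by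
    intro k
    have := HasDerivWithinAt.fun_sum (u := Finset.univ) fun l _ => (h1 l).const_mul (E.inc k l)
    simpa only [nodeCur₁] using this
  have hc2 : ∀ k, HasDerivWithinAt (fun τ => E.nodeCur₂ (δ τ) k) (E.nodeCur₂ z k) s t := by
    intro k
    have := HasDerivWithinAt.fun_sum (u := Finset.univ) fun l _ => (h2 l).const_mul (E.inc k l)
    simpa only [nodeCur₂] using this
  have ho : HasDerivWithinAt (fun τ => E.normYoSq (δ τ))
      (∑ k, 2 * (E.nodeCur₁ (δ t) k * E.nodeCur₁ z k + E.nodeCur₂ (δ t) k * E.nodeCur₂ z k)) s t := by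
    have := HasDerivWithinAt.fun_sum (u := Finset.univ) fun k _ =>
      ((hc1 k).mul (hc1 k)).add ((hc2 k).mul (hc2 k))
    have hf : (fun τ => E.normYoSq (δ τ))
        = fun τ => ∑ k, (E.nodeCur₁ (δ τ) k * E.nodeCur₁ (δ τ) k
            + E.nodeCur₂ (δ τ) k * E.nodeCur₂ (δ τ) k) := by
      funext τ
      simp only [normYoSq, dvocNsq, nodeCur]
      exact Finset.sum_congr rfl fun k _ => by ring
    rw [hf]
    refine this.congr_deriv (Finset.sum_congr rfl fun k _ => by ring)
  -- cycle currents
  have hy1 : ∀ c, HasDerivWithinAt (fun τ => E.cyc₁ C (δ τ) c) (E.cyc₁ C z c) s t := by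
    intro c
    have := HasDerivWithinAt.fun_sum (u := Finset.univ) fun l _ =>
      (h1 l).const_mul (C c l * E.ind l)
    simpa only [cyc₁] using this
  have hy2 : ∀ c, HasDerivWithinAt (fun τ => E.cyc₂ C (δ τ) c) (E.cyc₂ C z c) s t := by
    intro c
    have := HasDerivWithinAt.fun_sum (u := Finset.univ) fun l _ =>
      (h2 l).const_mul (C c l * E.ind l)
    simpa only [cyc₂] using this
  have hn : HasDerivWithinAt (fun τ => E.normYnSq C (δ τ))
      (∑ c, 2 * (E.cyc₁ C (δ t) c * E.cyc₁ C z c + E.cyc₂ C (δ t) c * E.cyc₂ C z c)) s t := by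
    have := HasDerivWithinAt.fun_sum (u := Finset.univ) fun c _ =>
      ((hy1 c).mul (hy1 c)).add ((hy2 c).mul (hy2 c))
    have hf : (fun τ => E.normYnSq C (δ τ))
        = fun τ => ∑ c, (E.cyc₁ C (δ τ) c * E.cyc₁ C (δ τ) c + E.cyc₂ C (δ τ) c * E.cyc₂ C (δ τ) c) := by
      funext τ
      simp only [normYnSq]
      exact Finset.sum_congr rfl fun c _ => by ring
    rw [hf]
    refine this.congr_deriv (Finset.sum_congr rfl fun c _ => by ring)
  have hW := (ho.add hn).const_mul (E.ρ / 2)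
  have hf : (fun τ => E.Wfun C (δ τ)) = fun τ => E.ρ / 2 * (E.normYoSq (δ τ) + E.normYnSq C (δ τ)) := by
    funext τ; simp only [Wfun]
  rw [hf]
  refine hW.congr_deriv ?_
  rw [← Finset.mul_sum, ← Finset.mul_sum]
  simp only [dW, dvocDot, nodeCur]
  ring


/-- Coordinates of a solution of (15): the voltage block. [cite: GrossEtAl2019, eq. (15a)] -/
theorem hasDerivWithinAt_v {γ : ℝ → DvocState N × LineState M} {s : Set ℝ} {t : ℝ}
    (hγ : HasDerivWithinAt γ (E.fullField W (γ t)) s t) (k : Fin N) :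
    HasDerivWithinAt (fun τ => (γ τ).1.1 k) (E.fv₁ W (γ t).1 (γ t).2 k) s t ∧
      HasDerivWithinAt (fun τ => (γ τ).1.2 k) (E.fv₂ W (γ t).1 (γ t).2 k) s t := by
  have hv : HasDerivWithinAt (fun τ => (γ τ).1) (E.fullField W (γ t)).1 s t := by
    simpa using hγ.hasFDerivWithinAt.fst.hasDerivWithinAt
  have hv1 : HasDerivWithinAt (fun τ => (γ τ).1.1) (E.fullField W (γ t)).1.1 s t := by
    simpa using hv.hasFDerivWithinAt.fst.hasDerivWithinAt
  have hv2 : HasDerivWithinAt (fun τ => (γ τ).1.2) (E.fullField W (γ t)).1.2 s t := by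
    simpa using hv.hasFDerivWithinAt.snd.hasDerivWithinAt
  exact ⟨by simpa [fullField, fvVec] using (hasDerivWithinAt_pi.1 hv1) k,
    by simpa [fullField, fvVec] using (hasDerivWithinAt_pi.1 hv2) k⟩

/-- Coordinates of a solution of (15): the line-current block. [cite: GrossEtAl2019, eq. (15b)] -/
theorem hasDerivWithinAt_i {γ : ℝ → DvocState N × LineState M} {s : Set ℝ} {t : ℝ}
    (hγ : HasDerivWithinAt γ (E.fullField W (γ t)) s t) (l : Fin M) :
    HasDerivWithinAt (fun τ => (γ τ).2.1 l) (E.fi₁ (γ t).1 (γ t).2 l) s t ∧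
      HasDerivWithinAt (fun τ => (γ τ).2.2 l) (E.fi₂ (γ t).1 (γ t).2 l) s t := by
  have hi : HasDerivWithinAt (fun τ => (γ τ).2) (E.fullField W (γ t)).2 s t := by
    simpa using hγ.hasFDerivWithinAt.snd.hasDerivWithinAt
  have hi1 : HasDerivWithinAt (fun τ => (γ τ).2.1) (E.fullField W (γ t)).2.1 s t := by
    simpa using hi.hasFDerivWithinAt.fst.hasDerivWithinAt
  have hi2 : HasDerivWithinAt (fun τ => (γ τ).2.2) (E.fullField W (γ t)).2.2 s t := by
    simpa using hi.hasFDerivWithinAt.snd.hasDerivWithinAt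
  exact ⟨by simpa [fullField, fiVec] using (hasDerivWithinAt_pi.1 hi1) l,
    by simpa [fullField, fiVec] using (hasDerivWithinAt_pi.1 hi2) l⟩

/-- **Deviation dynamics along (15)**: `ẏ = −L_T⁻¹Z_T y − Z_T⁻¹ ℬᵀ f_v(v, i)` for `y = i − i^s(v)`
(the boundary-layer field (18) plus the interconnection term of Prop. 6), coordinatewise
(`ρ ≠ 0`, `‖Y_l‖ ≠ 0`). [cite: GrossEtAl2019, §IV-C/F] -/
theorem hasDerivWithinAt_dev (hρ : E.ρ ≠ 0) (ha : ∀ l, E.a l ≠ 0)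
    {γ : ℝ → DvocState N × LineState M} {s : Set ℝ} {t : ℝ}
    (hγ : HasDerivWithinAt γ (E.fullField W (γ t)) s t) (l : Fin M) :
    HasDerivWithinAt (fun τ => (E.dev (γ τ).1 (γ τ).2).1 l)
        ((E.blVec (E.dev (γ t).1 (γ t).2) - E.iss (E.fvVec W (γ t).1 (γ t).2)).1 l) s t ∧
      HasDerivWithinAt (fun τ => (E.dev (γ τ).1 (γ τ).2).2 l)
        ((E.blVec (E.dev (γ t).1 (γ t).2) - E.iss (E.fvVec W (γ t).1 (γ t).2)).2 l) s t := by
  have hv := fun k => E.hasDerivWithinAt_v W hγ k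
  have hi := E.hasDerivWithinAt_i W hγ l
  set v := (γ t).1 with hvdef
  set i := (γ t).2 with hidef
  constructor
  · have hd := hi.1.sub (((((hv (E.src l)).1.sub (hv (E.dst l)).1).const_mul E.cκ).add
      (((hv (E.src l)).2.sub (hv (E.dst l)).2).const_mul E.sκ)).const_mul (E.a l))
    have hf : (fun τ => (E.dev (γ τ).1 (γ τ).2).1 l) = fun τ => (γ τ).2.1 l
        - E.a l * (E.cκ * ((γ τ).1.1 (E.src l) - (γ τ).1.1 (E.dst l))
          + E.sκ * ((γ τ).1.2 (E.src l) - (γ τ).1.2 (E.dst l))) := by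
      funext τ; simp [dev, iss, iss₁, dV₁, dV₂]
    rw [hf]
    refine hd.congr_deriv ?_
    rw [E.fi₁_eq_bl₁ hρ v i (ha l)]
    simp only [Prod.fst_sub, Pi.sub_apply, blVec, iss, iss₁, dV₁, dV₂, fvVec]
  · have hd := hi.2.sub (((((hv (E.src l)).1.sub (hv (E.dst l)).1).const_mul (-E.sκ)).add
      (((hv (E.src l)).2.sub (hv (E.dst l)).2).const_mul E.cκ)).const_mul (E.a l))
    have hf : (fun τ => (E.dev (γ τ).1 (γ τ).2).2 l) = fun τ => (γ τ).2.2 l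
        - E.a l * (-E.sκ * ((γ τ).1.1 (E.src l) - (γ τ).1.1 (E.dst l))
          + E.cκ * ((γ τ).1.2 (E.src l) - (γ τ).1.2 (E.dst l))) := by
      funext τ; simp [dev, iss, iss₂, dV₁, dV₂]
    rw [hf]
    refine hd.congr_deriv ?_
    rw [E.fi₂_eq_bl₂ hρ v i (ha l)]
    simp only [Prod.snd_sub, Pi.sub_apply, blVec, iss, iss₂, dV₁, dV₂, fvVec]

/-- **The derivative of `ν` along (15)**: for every solution of the full-order system, `ν` (32) has,
within `s` at `t`, the derivative `nuDot` (the printed decomposition with the `W`-terms evaluated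
exactly by Prop. 4 / §6 and the `V`-terms split as (26) + cross term).
[cite: GrossEtAl2019, proof of Prop. 7] -/
theorem hasDerivWithinAt_nu (h : E.Consistent W) (hρ : E.ρ ≠ 0) (ha : ∀ l, E.a l ≠ 0)
    (hC : E.IsCycle C) (d α₁ : ℝ) {γ : ℝ → DvocState N × LineState M} {s : Set ℝ} {t : ℝ}
    (hγ : HasDerivWithinAt γ (E.fullField W (γ t)) s t) :
    HasDerivWithinAt (fun τ => E.nu W C d α₁ (γ τ)) (E.nuDot W C d α₁ (γ t)) s t := by
  have hv := fun k => E.hasDerivWithinAt_v W hγ k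
  have hy := fun l => E.hasDerivWithinAt_dev W hρ ha hγ l
  have hV := hasDerivWithinAt_V_dir W α₁ (γ := fun τ => (γ τ).1) (u := E.fvVec W (γ t).1 (γ t).2)
    (fun k => (hv k).1) (fun k => (hv k).2)
  have hW := E.hasDerivWithinAt_W_dir C (δ := fun τ => E.dev (γ τ).1 (γ τ).2)
    (z := E.blVec (E.dev (γ t).1 (γ t).2) - E.iss (E.fvVec W (γ t).1 (γ t).2))
    (fun l => (hy l).1) (fun l => (hy l).2)
  have hsum := (hW.const_mul d).add (hV.const_mul (1 - d))
  have hf : (fun τ => E.nu W C d α₁ (γ τ))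
      = fun τ => d * E.Wfun C (E.dev (γ τ).1 (γ τ).2) + (1 - d) * W.V α₁ (γ τ).1 := by
    funext τ; simp only [nu]
  rw [hf]
  refine hsum.congr_deriv ?_
  rw [E.dW_blVec_sub_iss C hρ hC ha, E.dV_fvVec W h]
  simp only [nuDot]


/-! ## §10 Proposition 7: `ν` decreases along (15) under Condition 2's gain bound (35) -/

/-- The printed weight `d := β₁/(β₁ + β₂)` with `β₁ = ‖𝒦 − 𝓛‖⁻¹`, `β₂ = ρ‖𝒴‖`, written for the bounds
`κ₀, Υ` as `d = κ₀⁻¹/(κ₀⁻¹ + ρΥ) = 1/(1 + κ₀ρΥ)`. [cite: GrossEtAl2019, Prop. 7] -/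
def dWeight (κ₀ Υ : ℝ) : ℝ := 1 / (1 + κ₀ * E.ρ * Υ)

/-- `d = β₁/(β₁ + β₂)` literally. [cite: GrossEtAl2019, Prop. 7] -/
theorem dWeight_eq {κ₀ Υ : ℝ} (hκ₀ : κ₀ ≠ 0) (hS : 1 / κ₀ + E.ρ * Υ ≠ 0) :
    E.dWeight κ₀ Υ = (1 / κ₀) / (1 / κ₀ + E.ρ * Υ) := by
  unfold dWeight
  have : 1 + κ₀ * E.ρ * Υ ≠ 0 := by
    intro h0
    apply hS
    have : 1 / κ₀ + E.ρ * Υ = (1 + κ₀ * E.ρ * Υ) / κ₀ := by field_simp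
    rw [this, h0, zero_div]
  field_simp

/-- Entry `M₁₁ = (1 − d) α₁` of the printed matrix `M` (33). [cite: GrossEtAl2019, proof of Prop. 7] -/
def M11 (c κ₀ Υ : ℝ) : ℝ := (1 - E.dWeight κ₀ Υ) * W.alpha1 c κ₀

/-- Minus the off-diagonal entry of `M`: `((1 − d)β₁ + dβ₂)/2`. [cite: GrossEtAl2019, proof of Prop. 7] -/
def M12 (κ₀ Υ : ℝ) : ℝ := ((1 - E.dWeight κ₀ Υ) * (1 / κ₀) + E.dWeight κ₀ Υ * (E.ρ * Υ)) / 2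

/-- Entry `M₂₂ = (1 − γ) d`, `γ = ηρ‖𝒴‖`. [cite: GrossEtAl2019, proof of Prop. 7] -/
def M22 (κ₀ Υ : ℝ) : ℝ := E.dWeight κ₀ Υ * (1 - W.η * E.ρ * Υ)

/-- An explicit lower bound `det/trace` for the least eigenvalue of the `2 × 2` block of `M`.
[cite: GrossEtAl2019, proof of Prop. 7 («there exists χ₃ ∈ 𝒦 such that (33) holds»)] -/
def mLB (c κ₀ Υ : ℝ) : ℝ :=
  (E.M11 W c κ₀ Υ * E.M22 W κ₀ Υ - E.M12 κ₀ Υ ^ 2) / (E.M11 W c κ₀ Υ + E.M22 W κ₀ Υ)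

/-- A positive-definite binary form is bounded below by `(det/trace)·‖·‖²`. [folklore] -/
private theorem quadForm_lb {p q r : ℝ} (hp : 0 < p) (hr : 0 < r) (hdet : q ^ 2 < p * r) (ψ Y : ℝ) :
    (p * r - q ^ 2) / (p + r) * (ψ ^ 2 + Y ^ 2) ≤ p * ψ ^ 2 - 2 * q * ψ * Y + r * Y ^ 2 := by
  set m := (p * r - q ^ 2) / (p + r) with hm
  have hpr : 0 < p + r := by positivity
  have hpm : p - m = (p ^ 2 + q ^ 2) / (p + r) := by rw [hm]; field_simp; ring
  have hpm_pos : 0 < p - m := by rw [hpm]; positivity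
  have hprod : (p - m) * (r - m) - q ^ 2 = m ^ 2 := by rw [hm]; field_simp; ring
  have key : (p - m) * ((p - m) * ψ ^ 2 - 2 * q * ψ * Y + (r - m) * Y ^ 2)
      = ((p - m) * ψ - q * Y) ^ 2 + ((p - m) * (r - m) - q ^ 2) * Y ^ 2 := by ring
  have h0 : 0 ≤ (p - m) * ((p - m) * ψ ^ 2 - 2 * q * ψ * Y + (r - m) * Y ^ 2) := by
    rw [key, hprod]; positivity
  have h1 : 0 ≤ (p - m) * ψ ^ 2 - 2 * q * ψ * Y + (r - m) * Y ^ 2 :=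
    (mul_nonneg_iff_of_pos_left hpm_pos).1 h0
  linarith

/-- **Proposition 7, the estimate** [cite: GrossEtAl2019, Prop. 7 (first display of the proof)]:
«It follows from Propositions 3–6 … that
`(d/dt)ν ≤ −d‖y_o‖² − d‖y_n‖² + dβ₂ψ(v)‖y_o‖ + dγ‖y_o‖² − (1−d)α₁ψ(v)² + (1−d)β₁ψ(v)‖y_o‖ = −zᵀ M z`»,
`z = (ψ(v), ‖y_o‖, ‖y_n‖)`, for every state `x = (v, i)` of (15), `y = i − i^s(v)`. Hypotheses: the
reduced model's Prop. 3 data (`η > 0`, `α ≥ 0`, `v_k* > 0`, margin `c > 0` with (23) `DecreaseOnS c`,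
phase-error bound `κ₀` with `c ≤ κ₀`), the admittance bound `Υ ≥ 0`, `ρ > 0`, consistency, and a cycle
matrix. No gain condition is needed for this inequality. -/
theorem nuDot_le_quadForm [NeZero N] (h : E.Consistent W) {M₀ : ℕ} {C : Fin M₀ → Fin M → ℝ}
    (hρ : 0 < E.ρ) (hη : 0 < W.η) (hα : 0 ≤ W.α) (hv : ∀ k, 0 < W.vref k)
    {c κ₀ Υ : ℝ} (hc : 0 < c) (hκ₀ : 0 < κ₀) (hcκ : c ≤ κ₀) (hΥ : 0 ≤ Υ)
    (h23 : W.DecreaseOnS c) (hK : W.PhaseErrorBound κ₀) (hY : E.AdmittanceBound Υ)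
    (x : DvocState N × LineState M) :
    E.nuDot W C (E.dWeight κ₀ Υ) (W.alpha1 c κ₀) x
      ≤ -(E.M11 W c κ₀ Υ * W.psi κ₀ x.1 ^ 2
          - 2 * E.M12 κ₀ Υ * W.psi κ₀ x.1 * Real.sqrt (E.normYoSq (E.dev x.1 x.2))
          + E.M22 W κ₀ Υ * E.normYoSq (E.dev x.1 x.2)
          + E.dWeight κ₀ Υ * E.normYnSq C (E.dev x.1 x.2)) := by
  set d := E.dWeight κ₀ Υ with hd
  set α₁ := W.alpha1 c κ₀ with hα₁
  set v := x.1
  set i := x.2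
  set y := E.dev v i with hy
  set ψ := W.psi κ₀ v with hψ
  set Yo := Real.sqrt (E.normYoSq y) with hYo
  have hYo2 : Yo ^ 2 = E.normYoSq y := by rw [hYo, Real.sq_sqrt (E.normYoSq_nonneg y)]
  have hd0 : 0 ≤ d := by rw [hd]; unfold dWeight; positivity
  have hd1 : 0 ≤ 1 - d := by
    rw [hd]; unfold dWeight
    have h1 : 0 < 1 + κ₀ * E.ρ * Υ := by positivity
    have : 1 / (1 + κ₀ * E.ρ * Υ) ≤ 1 := by
      rw [div_le_iff₀ h1]; nlinarith [mul_nonneg (mul_nonneg hκ₀.le hρ.le) hΥ]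
    linarith
  -- the three printed ingredients
  have p3 : W.Vdot α₁ v ≤ -α₁ * ψ ^ 2 := W.Vdot_le_neg_alpha1_psi_sq hη hα hv hc hκ₀ h23 hK v
  have p5 : W.η * |dV W α₁ v (E.couple y)| ≤ 1 / κ₀ * ψ * Yo :=
    E.prop5 W hη.le hα hv hc.le hκ₀ hcκ v y
  have p6 : E.ρ * |dvocDot (E.nodeCur y) (E.admit (E.fvVec W v i))|
      ≤ E.ρ * Υ * ψ * Yo + W.η * E.ρ * Υ * E.normYoSq y :=
    E.prop6 W h hρ.le hη.le hα hv hκ₀.le hΥ hK hY v i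
  have a5 : -(W.η * dV W α₁ v (E.couple y)) ≤ 1 / κ₀ * ψ * Yo := by
    have := neg_abs_le (dV W α₁ v (E.couple y))
    nlinarith [abs_nonneg (dV W α₁ v (E.couple y))]
  have a6 : -(E.ρ * dvocDot (E.nodeCur y) (E.admit (E.fvVec W v i)))
      ≤ E.ρ * Υ * ψ * Yo + W.η * E.ρ * Υ * E.normYoSq y := by
    have := neg_abs_le (dvocDot (E.nodeCur y) (E.admit (E.fvVec W v i)))
    nlinarith [abs_nonneg (dvocDot (E.nodeCur y) (E.admit (E.fvVec W v i)))]
  -- combine with the nonnegative weights `d`, `1 − d`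
  have hWpart : d * (-(E.normYoSq y + E.normYnSq C y)
        - E.ρ * dvocDot (E.nodeCur y) (E.admit (E.fvVec W v i)))
      ≤ d * (-(E.normYoSq y + E.normYnSq C y) + (E.ρ * Υ * ψ * Yo + W.η * E.ρ * Υ * E.normYoSq y)) :=
    mul_le_mul_of_nonneg_left (by linarith) hd0
  have hVpart : (1 - d) * (W.Vdot α₁ v - W.η * dV W α₁ v (E.couple y))
      ≤ (1 - d) * (-α₁ * ψ ^ 2 + 1 / κ₀ * ψ * Yo) :=
    mul_le_mul_of_nonneg_left (by linarith) hd1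
  have hexp : E.nuDot W C d α₁ x = d * (-(E.normYoSq y + E.normYnSq C y)
        - E.ρ * dvocDot (E.nodeCur y) (E.admit (E.fvVec W v i)))
      + (1 - d) * (W.Vdot α₁ v - W.η * dV W α₁ v (E.couple y)) := rfl
  rw [hexp]
  simp only [M11, M12, M22, ← hd, ← hα₁]
  linarith [hWpart, hVpart]

/-- **(34)–(35)** [cite: GrossEtAl2019, Prop. 7]: under the second clause of Condition 2,
`η < c/(ρ‖𝒴‖(c + 5‖𝒦 − 𝓛‖))` (35) (stated with the bounds `Υ`, `κ₀`), the matrix `M` is positive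
definite: its `2 × 2` block satisfies `M₁₁ > 0`, `M₂₂ > 0`, `M₁₂² < M₁₁M₂₂`, so the explicit constant
`mLB = det/trace` is positive and `M₁₁ψ² − 2M₁₂ψY + M₂₂Y² ≥ mLB (ψ² + Y²)`. (Print: (34)
`1 < α₁/(α₁γ + β₁β₂) ⟹ M ≻ 0`, and (34) ⟸ (35).) -/
theorem M_posDef (hρ : 0 < E.ρ) (hη : 0 < W.η) {c κ₀ Υ : ℝ} (hc : 0 < c) (hκ₀ : 0 < κ₀) (hΥ : 0 < Υ)
    (h35 : W.η < c / (E.ρ * Υ * (c + 5 * κ₀))) :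
    0 < E.M11 W c κ₀ Υ ∧ 0 < E.M22 W κ₀ Υ ∧ E.M12 κ₀ Υ ^ 2 < E.M11 W c κ₀ Υ * E.M22 W κ₀ Υ ∧
      0 < E.mLB W c κ₀ Υ ∧
      ∀ ψ Y : ℝ, E.mLB W c κ₀ Υ * (ψ ^ 2 + Y ^ 2)
        ≤ E.M11 W c κ₀ Υ * ψ ^ 2 - 2 * E.M12 κ₀ Υ * ψ * Y + E.M22 W κ₀ Υ * Y ^ 2 := by
  have hD : 0 < 1 + κ₀ * E.ρ * Υ := by positivity
  -- (35) cleared of denominators: `ηρΥ(c + 5κ₀) < c`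
  have h35' : W.η * E.ρ * Υ * (c + 5 * κ₀) < c := by
    have hpos : 0 < E.ρ * Υ * (c + 5 * κ₀) := by positivity
    have := (lt_div_iff₀ hpos).1 h35
    linarith
  have hγ : W.η * E.ρ * Υ < 1 := by nlinarith
  have e11 : E.M11 W c κ₀ Υ = E.ρ * Υ * c / (5 * W.η * κ₀ * (1 + κ₀ * E.ρ * Υ)) := by
    unfold M11 dWeight DvocReduced.alpha1
    field_simp
    ring
  have e12 : E.M12 κ₀ Υ = E.ρ * Υ / (1 + κ₀ * E.ρ * Υ) := by
    unfold M12 dWeight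
    field_simp
    ring
  have e22 : E.M22 W κ₀ Υ = (1 - W.η * E.ρ * Υ) / (1 + κ₀ * E.ρ * Υ) := by
    unfold M22 dWeight
    field_simp
  have h11 : 0 < E.M11 W c κ₀ Υ := by rw [e11]; positivity
  have h22 : 0 < E.M22 W κ₀ Υ := by
    rw [e22]; exact div_pos (by linarith) hD
  have hdet : E.M12 κ₀ Υ ^ 2 < E.M11 W c κ₀ Υ * E.M22 W κ₀ Υ := by
    rw [e11, e12, e22, div_pow, div_mul_div_comm, div_lt_div_iff₀ (by positivity) (by positivity)]
    -- `ρ²Υ² · 5ηκ₀(1+κ₀ρΥ)·(1+κ₀ρΥ)² < ρΥc(1 − ηρΥ) · (1+κ₀ρΥ)²`, i.e. `5ηκ₀ρΥ < c(1 − ηρΥ)`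
    have hcore : 5 * W.η * κ₀ * (E.ρ * Υ) < c * (1 - W.η * E.ρ * Υ) := by nlinarith
    have hposA : 0 < E.ρ * Υ * (1 + κ₀ * E.ρ * Υ) ^ 2 * (1 + κ₀ * E.ρ * Υ) := by positivity
    nlinarith [mul_lt_mul_of_pos_left hcore hposA]
  have hm : 0 < E.mLB W c κ₀ Υ := by
    unfold mLB
    exact div_pos (by linarith) (by linarith)
  exact ⟨h11, h22, hdet, hm, fun ψ Y => quadForm_lb h11 h22 hdet ψ Y⟩

/-- **Proposition 7** [cite: GrossEtAl2019, Prop. 7]: «Let `d := β₁/(β₁+β₂)`. Under Condition 2 … 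
`(d/dt)ν ≤ −χ₃(‖x‖_{𝒯₀})` (33)», in the quantitative kernel form: for the full-order system (15) WITH
transmission-line dynamics, every `N` and `M`, under (23) with margin `c`, the bounds
`κ₀ ≥ ‖𝒦 − 𝓛‖` (`c ≤ κ₀`), `Υ ≥ ‖𝒴‖`, and the gain condition (35) `η < c/(ρΥ(c + 5κ₀))`, at every state
`x = (v, i)`:  `ν̇(x) ≤ −m (ψ(v)² + ‖y_o‖²) − d ‖y_n‖²` with the explicit `m = mLB > 0`, `d > 0`.
MODELLED: model (15) (dVOC converters as voltage sources, RL lines with uniform `ℓ/r`); this is a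
statement about the model, not about any grid. -/
theorem prop7 [NeZero N] (h : E.Consistent W) {M₀ : ℕ} {C : Fin M₀ → Fin M → ℝ}
    (hρ : 0 < E.ρ) (hη : 0 < W.η) (hα : 0 ≤ W.α) (hv : ∀ k, 0 < W.vref k)
    {c κ₀ Υ : ℝ} (hc : 0 < c) (hκ₀ : 0 < κ₀) (hcκ : c ≤ κ₀) (hΥ : 0 < Υ)
    (h23 : W.DecreaseOnS c) (hK : W.PhaseErrorBound κ₀) (hY : E.AdmittanceBound Υ)
    (h35 : W.η < c / (E.ρ * Υ * (c + 5 * κ₀))) (x : DvocState N × LineState M) :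
    E.nuDot W C (E.dWeight κ₀ Υ) (W.alpha1 c κ₀) x
      ≤ -(E.mLB W c κ₀ Υ) * (W.psi κ₀ x.1 ^ 2 + E.normYoSq (E.dev x.1 x.2))
        - E.dWeight κ₀ Υ * E.normYnSq C (E.dev x.1 x.2) := by
  have hq := E.nuDot_le_quadForm W h (C := C) hρ hη hα hv hc hκ₀ hcκ hΥ.le h23 hK hY x
  obtain ⟨_, _, _, _, hlb⟩ := E.M_posDef W hρ hη hc hκ₀ hΥ h35
  have hl := hlb (W.psi κ₀ x.1) (Real.sqrt (E.normYoSq (E.dev x.1 x.2)))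
  rw [Real.sq_sqrt (E.normYoSq_nonneg _)] at hl
  linarith

/-- `d > 0` and `mLB > 0` under (35): the right-hand side of Prop. 7 is a negative-definite function
of `(ψ(v), ‖y_o‖, ‖y_n‖)`. [cite: GrossEtAl2019, Prop. 7] -/
theorem prop7_constants_pos (hρ : 0 < E.ρ) (hη : 0 < W.η) {c κ₀ Υ : ℝ} (hc : 0 < c) (hκ₀ : 0 < κ₀)
    (hΥ : 0 < Υ) (h35 : W.η < c / (E.ρ * Υ * (c + 5 * κ₀))) :
    0 < E.dWeight κ₀ Υ ∧ 0 < E.mLB W c κ₀ Υ := by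
  refine ⟨by unfold dWeight; positivity, (E.M_posDef W hρ hη hc hκ₀ hΥ h35).2.2.2.1⟩

/-- «Therefore `(d/dt)ν(x) < 0` for all `(v, i) ∉ 𝒯₀`» [cite: GrossEtAl2019, proof of Prop. 7], in
the form: `ν̇(x) < 0` unless `ψ(v) = 0`, `y_o = ℬ y = 0`-in-norm and `y_n = 0`-in-norm
(`ψ(v) = 0 ↔ v ∈ (𝒮 ∩ 𝒜) ∪ {0}` is the tree's `DvocReduced.psi_eq_zero_iff`). -/
theorem nuDot_neg [NeZero N] (h : E.Consistent W) {M₀ : ℕ} {C : Fin M₀ → Fin M → ℝ}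
    (hρ : 0 < E.ρ) (hη : 0 < W.η) (hα : 0 ≤ W.α) (hv : ∀ k, 0 < W.vref k)
    {c κ₀ Υ : ℝ} (hc : 0 < c) (hκ₀ : 0 < κ₀) (hcκ : c ≤ κ₀) (hΥ : 0 < Υ)
    (h23 : W.DecreaseOnS c) (hK : W.PhaseErrorBound κ₀) (hY : E.AdmittanceBound Υ)
    (h35 : W.η < c / (E.ρ * Υ * (c + 5 * κ₀))) (x : DvocState N × LineState M)
    (hx : W.psi κ₀ x.1 ≠ 0 ∨ E.normYoSq (E.dev x.1 x.2) ≠ 0 ∨ E.normYnSq C (E.dev x.1 x.2) ≠ 0) :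
    E.nuDot W C (E.dWeight κ₀ Υ) (W.alpha1 c κ₀) x < 0 := by
  have h7 := E.prop7 W h (C := C) hρ hη hα hv hc hκ₀ hcκ hΥ h23 hK hY h35 x
  obtain ⟨hd, hm⟩ := E.prop7_constants_pos W hρ hη hc hκ₀ hΥ h35
  have ho := E.normYoSq_nonneg (E.dev x.1 x.2)
  have hn := E.normYnSq_nonneg C (E.dev x.1 x.2)
  have hψ2 := sq_nonneg (W.psi κ₀ x.1)
  rcases hx with hψ | hyo | hyn
  · have : 0 < W.psi κ₀ x.1 ^ 2 := by positivity
    nlinarith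
  · have : 0 < E.normYoSq (E.dev x.1 x.2) := lt_of_le_of_ne ho (Ne.symm hyo)
    nlinarith
  · have : 0 < E.normYnSq C (E.dev x.1 x.2) := lt_of_le_of_ne hn (Ne.symm hyn)
    nlinarith

/-- **Proposition 7 along solutions** [cite: GrossEtAl2019, Prop. 7 / proof of Theorem 2]: for every
solution of the full-order system (15), under the hypotheses of `prop7`, the composite function
`ν = dW + (1 − d)V` (32) has within `s` at `t` a derivative `≤ −mLB(ψ(v)² + ‖y_o‖²) − d‖y_n‖² ≤ 0`.
This is the kernel-checkable core of Theorem 2 (almost global asymptotic stability of `𝒯` for (15));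
the `𝒦∞`/`𝒦` packaging (24)/(33), Theorem 1 and the measure-zero clause are not formalized here. -/
theorem hasDerivWithinAt_nu_le [NeZero N] (h : E.Consistent W) {M₀ : ℕ} {C : Fin M₀ → Fin M → ℝ}
    (hC : E.IsCycle C) (hρ : 0 < E.ρ) (ha : ∀ l, E.a l ≠ 0) (hη : 0 < W.η) (hα : 0 ≤ W.α)
    (hv : ∀ k, 0 < W.vref k) {c κ₀ Υ : ℝ} (hc : 0 < c) (hκ₀ : 0 < κ₀) (hcκ : c ≤ κ₀) (hΥ : 0 < Υ)
    (h23 : W.DecreaseOnS c) (hK : W.PhaseErrorBound κ₀) (hY : E.AdmittanceBound Υ)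
    (h35 : W.η < c / (E.ρ * Υ * (c + 5 * κ₀)))
    {γ : ℝ → DvocState N × LineState M} {s : Set ℝ} {t : ℝ}
    (hγ : HasDerivWithinAt γ (E.fullField W (γ t)) s t) :
    ∃ D : ℝ, HasDerivWithinAt (fun τ => E.nu W C (E.dWeight κ₀ Υ) (W.alpha1 c κ₀) (γ τ)) D s t ∧
      D ≤ -(E.mLB W c κ₀ Υ) * (W.psi κ₀ (γ t).1 ^ 2 + E.normYoSq (E.dev (γ t).1 (γ t).2))
            - E.dWeight κ₀ Υ * E.normYnSq C (E.dev (γ t).1 (γ t).2) ∧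
      D ≤ 0 := by
  refine ⟨_, E.hasDerivWithinAt_nu W C h hρ.ne' ha hC _ _ hγ,
    E.prop7 W h hρ hη hα hv hc hκ₀ hcκ hΥ h23 hK hY h35 (γ t), ?_⟩
  have h7 := E.prop7 W h (C := C) hρ hη hα hv hc hκ₀ hcκ hΥ h23 hK hY h35 (γ t)
  obtain ⟨hd, hm⟩ := E.prop7_constants_pos W hρ hη hc hκ₀ hΥ h35
  have ho := E.normYoSq_nonneg (E.dev (γ t).1 (γ t).2)
  have hn := E.normYnSq_nonneg C (E.dev (γ t).1 (γ t).2)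
  nlinarith [sq_nonneg (W.psi κ₀ (γ t).1)]


end composite

/-! ## §11 `c ≤ ‖𝒦 − 𝓛‖` from (23), and Proposition 7 under Condition 2 as printed -/

/-- «Using (23) it can be verified that … `c ≤ ‖𝒦 − 𝓛‖`» [cite: GrossEtAl2019, App. proof of
Prop. 5]: for `N ≥ 2`, set-points `v_k* > 0` and `α ≥ 0`, the decrease inequality (23) with margin `c`
and a phase-error bound `κ₀ ≥ 0` force `c ≤ κ₀` (test (23) on a single-node voltage, which has
`‖v‖²_S = 1 − v_k*²/Λ > 0`, and use Cauchy–Schwarz). -/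
theorem c_le_kappa0 (hN : 2 ≤ N) (hv : ∀ k, 0 < W.vref k) (hα : 0 ≤ W.α) {c κ₀ : ℝ} (hκ₀ : 0 ≤ κ₀)
    (h23 : W.DecreaseOnS c) (hK : W.PhaseErrorBound κ₀) : c ≤ κ₀ := by
  let k₀ : Fin N := ⟨0, by omega⟩
  let j₀ : Fin N := ⟨1, by omega⟩
  have hkj : k₀ ≠ j₀ := by simp [k₀, j₀, Fin.ext_iff]
  haveI : NeZero N := ⟨by omega⟩
  have hΛpos : 0 < W.Lam := W.Lam_pos hv
  have hΛ : W.Lam ≠ 0 := hΛpos.ne'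
  -- the test vector: unit voltage on node `k₀`, first coordinate
  let v : DvocState N := (fun k => if k = k₀ then 1 else 0, fun _ => 0)
  have hdot : dvocDot v v = 1 := by
    simp [dvocDot, v, Finset.sum_ite_eq', Finset.mem_univ]
  have hs1 : W.sig₁ v = W.vref k₀ * cos (W.θ k₀) := by
    simp [DvocReduced.sig₁, v, Finset.sum_ite_eq', Finset.mem_univ]
  have hs2 : W.sig₂ v = -(W.vref k₀ * sin (W.θ k₀)) := by
    simp [DvocReduced.sig₂, v, Finset.sum_ite_eq', Finset.mem_univ]
  have hS : W.normS2 v = 1 - W.vref k₀ ^ 2 / W.Lam := by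
    simp only [DvocReduced.normS2, DvocReduced.qS, hdot, hs1, hs2]
    have sc := sin_sq_add_cos_sq (W.θ k₀)
    field_simp
    linear_combination (-(W.vref k₀ ^ 2)) * sc
  -- `Λ ≥ v_{k₀}*² + v_{j₀}*²`, so `‖v‖²_S > 0`
  have hΛge : W.vref k₀ ^ 2 + W.vref j₀ ^ 2 ≤ W.Lam := by
    unfold DvocReduced.Lam
    rw [← Finset.add_sum_erase Finset.univ (fun k => W.vref k ^ 2) (Finset.mem_univ k₀)]
    have : W.vref j₀ ^ 2 ≤ ∑ k ∈ Finset.univ.erase k₀, W.vref k ^ 2 :=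
      Finset.single_le_sum (f := fun k => W.vref k ^ 2) (fun k _ => sq_nonneg _)
        (Finset.mem_erase.2 ⟨hkj.symm, Finset.mem_univ j₀⟩)
    linarith
  have hSpos : 0 < W.normS2 v := by
    rw [hS]
    have hj : 0 < W.vref j₀ ^ 2 := pow_pos (hv j₀) 2
    have : W.vref k₀ ^ 2 / W.Lam < 1 := by
      rw [div_lt_one hΛpos]; linarith
    linarith
  -- (23) on `v`, then Cauchy–Schwarz with the phase-error bound
  have h1 := h23 v
  have hcs : |W.qS v (W.eθ v)| ≤ Real.sqrt (W.normS2 v) * (κ₀ * Real.sqrt (W.normS2 v)) := by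
    rw [W.qS_eq_dot_projS]
    refine (abs_dvocDot_le (W.projS v) (W.eθ v)).trans ?_
    rw [← W.normS2_eq_sum_nsq_projS hΛ]
    refine mul_le_mul_of_nonneg_left ?_ (Real.sqrt_nonneg _)
    have he : (∑ k, dvocNsq (W.eθ v) k) = ∑ k, (W.eθ₁ v k ^ 2 + W.eθ₂ v k ^ 2) := by
      simp [dvocNsq, DvocReduced.eθ]
    rw [he]
    calc Real.sqrt (∑ k, (W.eθ₁ v k ^ 2 + W.eθ₂ v k ^ 2))
        ≤ Real.sqrt (κ₀ ^ 2 * W.normS2 v) := Real.sqrt_le_sqrt (hK v)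
      _ = κ₀ * Real.sqrt (W.normS2 v) := by
          rw [Real.sqrt_mul' _ (W.normS2_nonneg hΛ v), Real.sqrt_sq hκ₀]
  have hsq : Real.sqrt (W.normS2 v) * (κ₀ * Real.sqrt (W.normS2 v)) = κ₀ * W.normS2 v := by
    have := Real.mul_self_sqrt (W.normS2_nonneg hΛ v)
    linear_combination κ₀ * this
  rw [hsq] at hcs
  have hneg := neg_abs_le (W.qS v (W.eθ v))
  -- `c‖v‖²_S ≤ −vᵀP_S e_θ(v) − α‖v‖²_S ≤ κ₀‖v‖²_S`
  have hαS : 0 ≤ W.α * W.normS2 v := mul_nonneg hα hSpos.le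
  have : c * W.normS2 v ≤ κ₀ * W.normS2 v := by linarith
  exact le_of_mul_le_mul_right this hSpos

/-- **Proposition 7 under Condition 2 as printed (every `N ≥ 2`, every `M`)**
[cite: GrossEtAl2019, Condition 2, Prop. 7]: the hypotheses of the reduced-model Proposition 3 in
their printed Condition-2 form (certified `λ ≤ λ₂(L)`, angle bound `θ̄`, `v_min* ≤ v_k* ≤ v_max*`,
nodewise inequality with margin `c > 0`; per-node data bounds `‖K_k‖² ≤ κ_K²`, `Σ_j‖Y_jk‖ ≤ d`
giving `κ₀ = κ_K + 2d ≥ ‖𝒦 − 𝓛‖` — the tree's `decreaseOnS_of_condition2`/`phaseErrorBound_of_bounds`),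
the admittance bound `Υ`, and Condition 2's SECOND inequality (35) with these bounds,
`η < c/(ρΥ(c + 5κ₀))`, give Prop. 7's decrease estimate at every state of (15). -/
theorem prop7_of_condition2 (hN : 2 ≤ N) (h : E.Consistent W) {M₀ : ℕ} {C : Fin M₀ → Fin M → ℝ}
    (hsym : ∀ k j, W.w k j = W.w j k) (hw : ∀ k j, 0 ≤ W.w k j)
    (hρ : 0 < E.ρ) (hη : 0 < W.η) (hα : 0 ≤ W.α) (hv : ∀ k, 0 < W.vref k)
    {lam c θbar vmin vmax κK d Υ : ℝ} (hc : 0 < c)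
    (hlam : ∀ z : Fin N → ℝ,
      lam * pairNormSq z ≤ N * (1 / 2 * ∑ i, ∑ j, W.w i j * (z i - z j) ^ 2))
    (hθ0 : 0 ≤ θbar) (hθπ : θbar ≤ π) (hang : ∀ j k, |W.θ j - W.θ k| ≤ θbar)
    (hvmin : 0 < vmin) (hmin : ∀ k, vmin ≤ W.vref k) (hmax : ∀ k, W.vref k ≤ vmax)
    (hcond : ∀ k,
      W.nodeGainAbs k + W.α < (1 + cos θbar) / 2 * (vmin ^ 2 / vmax ^ 2) * lam - c)
    (hκK : 0 < κK) (hKk : ∀ k, W.nodeGain k ^ 2 + W.nodeRot k ^ 2 ≤ κK ^ 2)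
    (hd : ∀ k, ∑ j, W.w k j ≤ d) (hΥ : 0 < Υ) (hY : E.AdmittanceBound Υ)
    (h35 : W.η < c / (E.ρ * Υ * (c + 5 * (κK + 2 * d)))) (x : DvocState N × LineState M) :
    E.nuDot W C (E.dWeight (κK + 2 * d) Υ) (W.alpha1 c (κK + 2 * d)) x
      ≤ -(E.mLB W c (κK + 2 * d) Υ) * (W.psi (κK + 2 * d) x.1 ^ 2 + E.normYoSq (E.dev x.1 x.2))
        - E.dWeight (κK + 2 * d) Υ * E.normYnSq C (E.dev x.1 x.2) := by
  haveI : NeZero N := ⟨by omega⟩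
  have k0 : Fin N := ⟨0, by omega⟩
  have hd0 : 0 ≤ d := (Finset.sum_nonneg fun j _ => hw k0 j).trans (hd k0)
  have hκ₀ : 0 < κK + 2 * d := by positivity
  have h23 := W.decreaseOnS_of_condition2 hsym hw hv hα hc.le hlam hθ0 hθπ hang hvmin hmin hmax hcond
  have hK := W.phaseErrorBound_of_bounds hsym hw hv hκK.le hKk hd
  have hcκ := c_le_kappa0 W hN hv hα hκ₀.le h23 hK
  exact E.prop7 W h hρ hη hα hv hc hκ₀ hcκ hΥ h23 hK hY h35 x


/-! ## §12 The target set `𝒯` (16) and `ν` as a Lyapunov function of (15) (append 2026-08-27, same source)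

[GrossEtAl2019 §IV-A p0005]: «𝒯 := {x ∈ ℝⁿ | x = (v, i), v ∈ 𝒮 ∩ 𝒜, i = i^s(v)} (16) … all elements of
𝒯 are equilibria for the dynamics in the rotating reference frame (15) … 𝒯₀ := 𝒯 ∪ {0ₙ}»; proof of
Theorem 2 p0007: «χ̃₁(‖v‖_{𝒮∩𝒜}, ‖y‖) ≤ ν(x) ≤ χ̃₂(…)» (here: `ν ≥ 0` with zero set exactly `𝒯`) and
«Proposition 7 guarantees … (d/dt)ν ≤ −χ₃(‖x‖_{𝒯₀})» (here: `ν` non-increasing along every solution of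
(15), integrated on solution intervals). -/

section target

variable {M₀ : ℕ} (C : Fin M₀ → Fin M → ℝ)

/-- **(16)** membership in the target set `𝒯 = {(v, i) | v ∈ 𝒮 ∩ 𝒜, i = i^s(v)}`
(`𝒮` = tree `DvocReduced.InS`, `𝒜 = {‖v_k‖ = v_k* ∀k}`). [cite: GrossEtAl2019, eq. (16)] -/
def InT (x : DvocState N × LineState M) : Prop :=
  W.InS x.1 ∧ (∀ k, dvocNsq x.1 k = W.vref k ^ 2) ∧ x.2 = E.iss x.1

/-- «all elements of 𝒯 are equilibria for the dynamics in the rotating reference frame (15)»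
(under consistency, `ρ ≠ 0`, `‖Y_l‖ ≠ 0`, `v_k* ≠ 0`). [cite: GrossEtAl2019, §IV-A (after (16))] -/
theorem fullField_eq_zero_of_InT (h : E.Consistent W) (hρ : E.ρ ≠ 0) (ha : ∀ l, E.a l ≠ 0)
    (hv : ∀ k, W.vref k ≠ 0) {x : DvocState N × LineState M} (hx : E.InT W x) :
    E.fullField W x = 0 := by
  obtain ⟨hS, hA, hi⟩ := hx
  have he := W.eθ_of_InS hS hv
  have hΦ : ∀ k, W.Phi x.1 k = 0 := fun k => by
    simp [DvocReduced.Phi, hA k]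
  refine Prod.ext ?_ ?_
  · show E.fvVec W x.1 x.2 = 0
    rw [hi, E.fvVec_iss W h]
    refine Prod.ext (funext fun k => ?_) (funext fun k => ?_)
    · have h1 := congrArg (fun u : DvocState N => u.1 k) he
      simp only [DvocReduced.eθ] at h1
      simp [DvocReduced.field, DvocReduced.g₁, hΦ k, h1]
    · have h2 := congrArg (fun u : DvocState N => u.2 k) he
      simp only [DvocReduced.eθ] at h2
      simp [DvocReduced.field, DvocReduced.g₂, hΦ k, h2]
  · show E.fiVec x.1 x.2 = 0
    rw [hi]
    exact E.fiVec_iss hρ ha x.1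

/-- `ν ≥ 0` for `0 ≤ d ≤ 1`, `ρ ≥ 0`, `ηαα₁ ≥ 0`, `Λ ≠ 0`. [cite: GrossEtAl2019, proof of Thm. 2
(the lower comparison bound of `ν`)] -/
theorem nu_nonneg (hΛ : W.Lam ≠ 0) (hρ : 0 ≤ E.ρ) {d α₁ : ℝ} (hd0 : 0 ≤ d) (hd1 : d ≤ 1)
    (hw : 0 ≤ W.η * W.α * α₁) (x : DvocState N × LineState M) : 0 ≤ E.nu W C d α₁ x := by
  unfold nu
  have h1 := E.Wfun_nonneg C hρ (E.dev x.1 x.2)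
  have h2 := W.V_nonneg hΛ hw x.1
  have : 0 ≤ 1 - d := by linarith
  positivity

/-- **Zero set of `ν` is `𝒯`** (`0 < d < 1`, `ρ > 0`, `ηαα₁ > 0`, `v_k* ≠ 0`, `Λ ≠ 0`, and — for the
`W`-part, as in Prop. 4 — injectivity of `y ↦ (ℬy, B_nᵀL_T y)`): `ν(x) = 0 ↔ x ∈ 𝒯`.
[cite: GrossEtAl2019, eq. (16) and proof of Thm. 2] -/
theorem nu_eq_zero_iff (hΛ : W.Lam ≠ 0) (hρ : 0 < E.ρ) {d α₁ : ℝ} (hd0 : 0 < d) (hd1 : d < 1)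
    (hw : 0 < W.η * W.α * α₁) (hv : ∀ k, W.vref k ≠ 0)
    (hinj : ∀ y : LineState M, E.nodeCur y = 0 → (∀ c, E.cyc₁ C y c = 0 ∧ E.cyc₂ C y c = 0) → y = 0)
    (x : DvocState N × LineState M) : E.nu W C d α₁ x = 0 ↔ E.InT W x := by
  have hW0 := E.Wfun_nonneg C hρ.le (E.dev x.1 x.2)
  have hV0 := W.V_nonneg hΛ hw.le x.1
  constructor
  · intro h
    unfold nu at h
    have hW : E.Wfun C (E.dev x.1 x.2) = 0 := by nlinarith
    have hV : W.V α₁ x.1 = 0 := by nlinarith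
    obtain ⟨hS, hA⟩ := (W.V_eq_zero_iff hΛ hw hv x.1).1 hV
    have hy := (E.Wfun_eq_zero_iff C hρ hinj (E.dev x.1 x.2)).1 hW
    exact ⟨hS, hA, by simpa [dev, sub_eq_zero] using hy⟩
  · rintro ⟨hS, hA, hi⟩
    have hV : W.V α₁ x.1 = 0 := (W.V_eq_zero_iff hΛ hw hv x.1).2 ⟨hS, hA⟩
    have hy : E.dev x.1 x.2 = 0 := by simp [dev, hi]
    have hW : E.Wfun C (E.dev x.1 x.2) = 0 := by
      rw [hy]; exact (E.Wfun_eq_zero_iff C hρ hinj 0).2 rfl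
    simp [nu, hV, hW]

/-- **`ν` is a Lyapunov function of the full-order system (15)** — Prop. 7 integrated: under the
hypotheses of `prop7` (Condition 2 incl. (35), via the bounds `κ₀`, `Υ`), along every solution of (15)
on `[0, T]` the composite function `ν` (32) is NON-INCREASING: `ν(x(t)) ≤ ν(x(s))` for
`0 ≤ s ≤ t ≤ T`. [cite: GrossEtAl2019, Prop. 7 and proof of Thm. 2] -/
theorem nu_antitoneOn [NeZero N] (h : E.Consistent W) (hC : E.IsCycle C) (hρ : 0 < E.ρ)
    (ha : ∀ l, E.a l ≠ 0) (hη : 0 < W.η) (hα : 0 ≤ W.α) (hv : ∀ k, 0 < W.vref k)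
    {c κ₀ Υ : ℝ} (hc : 0 < c) (hκ₀ : 0 < κ₀) (hcκ : c ≤ κ₀) (hΥ : 0 < Υ)
    (h23 : W.DecreaseOnS c) (hK : W.PhaseErrorBound κ₀) (hY : E.AdmittanceBound Υ)
    (h35 : W.η < c / (E.ρ * Υ * (c + 5 * κ₀)))
    {γ : ℝ → DvocState N × LineState M} {T : ℝ} (hsol : E.IsSolutionOn W γ (Set.Icc 0 T)) :
    AntitoneOn (fun τ => E.nu W C (E.dWeight κ₀ Υ) (W.alpha1 c κ₀) (γ τ)) (Set.Icc 0 T) := by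
  have hd : ∀ τ ∈ Set.Icc 0 T, HasDerivWithinAt
      (fun σ => E.nu W C (E.dWeight κ₀ Υ) (W.alpha1 c κ₀) (γ σ))
      (E.nuDot W C (E.dWeight κ₀ Υ) (W.alpha1 c κ₀) (γ τ)) (Set.Icc 0 T) τ :=
    fun τ hτ => E.hasDerivWithinAt_nu W C h hρ.ne' ha hC _ _ (hsol τ hτ)
  refine antitoneOn_of_hasDerivWithinAt_nonpos
    (f' := fun τ => E.nuDot W C (E.dWeight κ₀ Υ) (W.alpha1 c κ₀) (γ τ))
    (convex_Icc 0 T) (fun τ hτ => (hd τ hτ).continuousWithinAt)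
    (fun τ hτ => (hd τ (interior_subset hτ)).mono interior_subset) (fun τ hτ => ?_)
  have h7 := E.prop7 W h (C := C) hρ hη hα hv hc hκ₀ hcκ hΥ h23 hK hY h35 (γ τ)
  obtain ⟨hdw, hm⟩ := E.prop7_constants_pos W hρ hη hc hκ₀ hΥ h35
  have ho := E.normYoSq_nonneg (E.dev (γ τ).1 (γ τ).2)
  have hn := E.normYnSq_nonneg C (E.dev (γ τ).1 (γ τ).2)
  nlinarith [sq_nonneg (W.psi κ₀ (γ τ).1)]

/-- The same under Condition 2 as printed (`N ≥ 2`; hypotheses of `prop7_of_condition2`):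
`ν(x(t)) ≤ ν(x(0))` for every solution of (15) on `[0, T]` and every `t ∈ [0, T]`.
[cite: GrossEtAl2019, Prop. 7 and proof of Thm. 2] -/
theorem nu_le_nu_zero_of_condition2 (hN : 2 ≤ N) (h : E.Consistent W) (hC : E.IsCycle C)
    (hsym : ∀ k j, W.w k j = W.w j k) (hw : ∀ k j, 0 ≤ W.w k j)
    (hρ : 0 < E.ρ) (ha : ∀ l, E.a l ≠ 0) (hη : 0 < W.η) (hα : 0 ≤ W.α) (hv : ∀ k, 0 < W.vref k)
    {lam c θbar vmin vmax κK d Υ : ℝ} (hc : 0 < c)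
    (hlam : ∀ z : Fin N → ℝ,
      lam * pairNormSq z ≤ N * (1 / 2 * ∑ i, ∑ j, W.w i j * (z i - z j) ^ 2))
    (hθ0 : 0 ≤ θbar) (hθπ : θbar ≤ π) (hang : ∀ j k, |W.θ j - W.θ k| ≤ θbar)
    (hvmin : 0 < vmin) (hmin : ∀ k, vmin ≤ W.vref k) (hmax : ∀ k, W.vref k ≤ vmax)
    (hcond : ∀ k,
      W.nodeGainAbs k + W.α < (1 + cos θbar) / 2 * (vmin ^ 2 / vmax ^ 2) * lam - c)
    (hκK : 0 < κK) (hKk : ∀ k, W.nodeGain k ^ 2 + W.nodeRot k ^ 2 ≤ κK ^ 2)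
    (hd : ∀ k, ∑ j, W.w k j ≤ d) (hΥ : 0 < Υ) (hY : E.AdmittanceBound Υ)
    (h35 : W.η < c / (E.ρ * Υ * (c + 5 * (κK + 2 * d))))
    {γ : ℝ → DvocState N × LineState M} {T : ℝ} (hsol : E.IsSolutionOn W γ (Set.Icc 0 T))
    {t : ℝ} (ht : t ∈ Set.Icc 0 T) :
    E.nu W C (E.dWeight (κK + 2 * d) Υ) (W.alpha1 c (κK + 2 * d)) (γ t)
      ≤ E.nu W C (E.dWeight (κK + 2 * d) Υ) (W.alpha1 c (κK + 2 * d)) (γ 0) := by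
  haveI : NeZero N := ⟨by omega⟩
  have k0 : Fin N := ⟨0, by omega⟩
  have hd0 : 0 ≤ d := (Finset.sum_nonneg fun j _ => hw k0 j).trans (hd k0)
  have hκ₀ : 0 < κK + 2 * d := by positivity
  have h23 := W.decreaseOnS_of_condition2 hsym hw hv hα hc.le hlam hθ0 hθπ hang hvmin hmin hmax hcond
  have hK := W.phaseErrorBound_of_bounds hsym hw hv hκK.le hKk hd
  have hcκ := c_le_kappa0 W hN hv hα hκ₀.le h23 hK
  have hanti := E.nu_antitoneOn W C h hC hρ ha hη hα hv hc hκ₀ hcκ hΥ h23 hK hY h35 hsol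
  have h0 : (0 : ℝ) ∈ Set.Icc 0 T := Set.left_mem_Icc.2 (ht.1.trans ht.2)
  exact hanti h0 ht ht.1

end target

/-! ## §13 `‖𝒴‖ = ‖𝓛‖ ≤ 2 d_max` and Proposition 7 in Proposition 2's power-flow form (append
2026-08-27, same source)

[GrossEtAl2019, App. proof of Prop. 2, p0010]: «‖𝓛‖ = ‖L‖ ≤ 2 max_k Σ_{j:(j,k)∈E} ‖Y_jk‖. Finally,
because R(κ) is a rotation matrix it holds that ‖𝒴‖ = ‖R(κ)ᵀ𝓛‖ = ‖𝓛‖», and [Prop. 2, p0005]: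
«… η < c/(2ρ d_max (c + 5 max_k s_k* v_k*⁻² + 10 d_max))». So the admittance bound of §7 needs NO
certificate of its own: `Υ := 2 d_max` with the same weighted-degree bound `d` that already feeds
`‖𝒦 − 𝓛‖ ≤ κ_K + 2d` (tree `phaseErrorBound_of_bounds`). -/

section prop2form

variable {M₀ : ℕ} (C : Fin M₀ → Fin M → ℝ)

/-- «`‖𝒴‖ = ‖R(κ)ᵀ𝓛‖ = ‖𝓛‖`» componentwise: `‖(𝒴u)_k‖² = ‖(𝓛u)_k‖²` (under consistency).
[cite: GrossEtAl2019, App. proof of Prop. 2] -/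
theorem nsq_admit_eq (h : E.Consistent W) (u : DvocState N) (k : Fin N) :
    dvocNsq (E.admit u) k = W.lap₁ u k ^ 2 + W.lap₂ u k ^ 2 := by
  obtain ⟨h1, h2⟩ := E.rot_admit u k
  have hcs := E.cκ_sq_add_sκ_sq
  rw [E.lap₁_eq_lineLap₁ W h, E.lap₂_eq_lineLap₂ W h, ← h1, ← h2]
  simp only [dvocNsq]
  linear_combination (-(((E.admit u).1 k) ^ 2) - ((E.admit u).2 k) ^ 2) * hcs

/-- **`‖𝒴‖ ≤ 2 d_max`**: for symmetric nonnegative weights consistent with the line set and weighted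
degrees `Σ_j ‖Y_jk‖ ≤ d` (`d ≥ 0`), the admittance bound holds with `Υ = 2d`
(= «‖𝒴‖ = ‖𝓛‖ ≤ 2 max_k Σ_j ‖Y_jk‖», via the tree's `nsq_lap_le`).
[cite: GrossEtAl2019, App. proof of Prop. 2] -/
theorem admittanceBound_of_degree (h : E.Consistent W) (hsym : ∀ k j, W.w k j = W.w j k)
    (hw : ∀ k j, 0 ≤ W.w k j) {d : ℝ} (hd0 : 0 ≤ d) (hd : ∀ k, ∑ j, W.w k j ≤ d) :
    E.AdmittanceBound (2 * d) := by
  intro u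
  have := W.nsq_lap_le hsym hw hd0 hd u
  calc (∑ k, dvocNsq (E.admit u) k) = ∑ k, (W.lap₁ u k ^ 2 + W.lap₂ u k ^ 2) :=
        Finset.sum_congr rfl fun k _ => E.nsq_admit_eq W h u k
    _ ≤ (2 * d) ^ 2 * ∑ k, dvocNsq u k := this

/-- `κ = tan⁻¹(ρω₀) ∈ [0, π/2]` for `ρω₀ ≥ 0` (the range used by Prop. 2). [cite: GrossEtAl2019,
App. proof of Prop. 2 («noting that 0 ≤ κ ≤ π/2»)] -/
theorem arctan_mem (hρω : 0 ≤ E.ρ * E.ω₀) :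
    0 ≤ Real.arctan (E.ρ * E.ω₀) ∧ Real.arctan (E.ρ * E.ω₀) ≤ π / 2 := by
  constructor
  · rw [← Real.arctan_zero]; exact Real.arctan_strictMono.monotone hρω
  · exact (Real.arctan_lt_pi_div_two _).le

/-- **Proposition 7 in Proposition 2's power-flow form (every `N ≥ 2`, every `M`)**
[cite: GrossEtAl2019, Prop. 2 and Prop. 7]: for the full-order system (15) with `κ = tan⁻¹(ρω₀)`,
`ω₀ ≥ 0`, `ρ > 0`, symmetric nonnegative weights consistent with the line set, set-points
`0 < v_min ≤ v_k* ≤ v_max`, angles `|θ_j − θ_k| ≤ π/2`, a margin `c > 0`, a certified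
`λ ≤ λ₂(L)` (variational form), per-node data bounds `‖K_k‖ ≤ κ_K` (= `s_k*/v_k*²` under
Condition 1, tree `KnormSq_eq_apparentPower`) and weighted degrees `Σ_j‖Y_jk‖ ≤ d` (`d > 0`), and
the two PRINTED inequalities of Prop. 2 —
`Σ_j ((cos κ/v_k*²)|p_jk*| + (sin κ/v_k*²)|q_jk*|) + α ≤ (v_min²/(2v_max²)) λ − c` for every `k`, and
`η < c/(2ρ d (c + 5κ_K + 10 d))` — the composite function `ν` with `κ₀ = κ_K + 2d`, `Υ = 2d`
satisfies Prop. 7's estimate at every state and is non-increasing along every solution on `[0, T]`.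
No operator norm and no PSD certificate is left: all hypotheses are finitely many inequalities on
the instance data plus the `λ₂` certificate. -/
theorem prop7_of_proposition2 (hN : 2 ≤ N) (h : E.Consistent W) (hC : E.IsCycle C)
    (hsym : ∀ k j, W.w k j = W.w j k) (hw : ∀ k j, 0 ≤ W.w k j)
    (hρ : 0 < E.ρ) (hω : 0 ≤ E.ω₀) (ha : ∀ l, E.a l ≠ 0) (hη : 0 < W.η) (hα : 0 ≤ W.α)
    (hv : ∀ k, 0 < W.vref k) {lam c vmin vmax κK d : ℝ} (hc : 0 < c)
    (hlam : ∀ z : Fin N → ℝ,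
      lam * pairNormSq z ≤ N * (1 / 2 * ∑ i, ∑ j, W.w i j * (z i - z j) ^ 2))
    (hang : ∀ j k, |W.θ j - W.θ k| ≤ π / 2)
    (hvmin : 0 < vmin) (hmin : ∀ k, vmin ≤ W.vref k) (hmax : ∀ k, W.vref k ≤ vmax)
    (hprop2 : ∀ k, ∑ j, (cos (Real.arctan (E.ρ * E.ω₀)) / W.vref k ^ 2
          * |W.pBranch (Real.arctan (E.ρ * E.ω₀)) k j|
        + sin (Real.arctan (E.ρ * E.ω₀)) / W.vref k ^ 2
          * |W.qBranch (Real.arctan (E.ρ * E.ω₀)) k j|) + W.α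
        ≤ vmin ^ 2 / (2 * vmax ^ 2) * lam - c)
    (hκK : 0 < κK) (hKk : ∀ k, W.nodeGain k ^ 2 + W.nodeRot k ^ 2 ≤ κK ^ 2)
    (hdpos : 0 < d) (hd : ∀ k, ∑ j, W.w k j ≤ d)
    (hη2 : W.η < c / (2 * E.ρ * d * (c + 5 * κK + 10 * d))) :
    (∀ x : DvocState N × LineState M,
      E.nuDot W C (E.dWeight (κK + 2 * d) (2 * d)) (W.alpha1 c (κK + 2 * d)) x
        ≤ -(E.mLB W c (κK + 2 * d) (2 * d)) * (W.psi (κK + 2 * d) x.1 ^ 2 + E.normYoSq (E.dev x.1 x.2))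
          - E.dWeight (κK + 2 * d) (2 * d) * E.normYnSq C (E.dev x.1 x.2)) ∧
    (0 < E.mLB W c (κK + 2 * d) (2 * d)) ∧
    ∀ {γ : ℝ → DvocState N × LineState M} {T : ℝ}, E.IsSolutionOn W γ (Set.Icc 0 T) →
      AntitoneOn (fun τ => E.nu W C (E.dWeight (κK + 2 * d) (2 * d)) (W.alpha1 c (κK + 2 * d)) (γ τ))
        (Set.Icc 0 T) := by
  haveI : NeZero N := ⟨by omega⟩
  obtain ⟨hκ0, hκ1⟩ := E.arctan_mem (mul_nonneg hρ.le hω)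
  have hκ₀ : 0 < κK + 2 * d := by positivity
  have hΥ : 0 < 2 * d := by positivity
  have h23 := W.decreaseOnS_of_proposition2 hsym hw hv hα hκ0 hκ1 hc hlam hang hvmin hmin hmax hprop2
  have hK := W.phaseErrorBound_of_bounds hsym hw hv hκK.le hKk hd
  have hY := E.admittanceBound_of_degree W h hsym hw hdpos.le hd
  have hcκ := c_le_kappa0 W hN hv hα hκ₀.le h23 hK
  -- the printed `η`-inequality of Prop. 2 IS (35) with `Υ = 2d`, `κ₀ = κ_K + 2d`
  have h35 : W.η < c / (E.ρ * (2 * d) * (c + 5 * (κK + 2 * d))) := by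
    have : E.ρ * (2 * d) * (c + 5 * (κK + 2 * d)) = 2 * E.ρ * d * (c + 5 * κK + 10 * d) := by ring
    rw [this]; exact hη2
  refine ⟨fun x => E.prop7 W h hρ hη hα hv hc hκ₀ hcκ hΥ h23 hK hY h35 x,
    (E.prop7_constants_pos W hρ hη hc hκ₀ hΥ h35).2, fun hsol => ?_⟩
  exact E.nu_antitoneOn W C h hC hρ ha hη hα hv hc hκ₀ hcκ hΥ h23 hK hY h35 hsol

end prop2form

/-! ## §14 Positive-definiteness of `W` from a spanning cycle basis (Prop. 4, first statement)
(append 2026-08-27, same source)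

[GrossEtAl2019, §IV-E / proof of Prop. 4, p0007]: «the matrix B_n ∈ ℝ^{M×M₀} whose columns span the
nullspace of B … Because B_n has full rank, it holds that B_nᵀ L_T B_n ≻ 0. Next, we can parametrize
all y such that ℬy = 0_{2N} using ξ ∈ ℝ^{2M₀} and y = B_n ξ … Thus, W(y) is positive definite». Here:
if the rows of the cycle matrix `C` SPAN `ker B` and `ℓ_l > 0`, the map `y ↦ (ℬy, B_nᵀL_T y)` is
injective — the hypothesis of `Wfun_eq_zero_iff` / `nu_eq_zero_iff` — by a two-line orthogonality
argument (`ℬy = 0` puts each coordinate vector of `y` in `ker B`, `C L_T y = 0` puts `L_T y` in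
`(ker B)^⊥`, so `yᵀL_T y = 0`). -/

section spanning

variable {M₀ : ℕ} (C : Fin M₀ → Fin M → ℝ)

/-- The rows of `C` SPAN the cycle space `ker B`: every `z ∈ ℝ^M` with `B z = 0` is a linear
combination of the rows (print: the columns of `B_n = Cᵀ` span the nullspace of `B`).
[cite: GrossEtAl2019, §IV-E] -/
def SpansCycles (C : Fin M₀ → Fin M → ℝ) : Prop :=
  ∀ z : Fin M → ℝ, (∀ k : Fin N, ∑ l, E.inc k l * z l = 0) →
    ∃ coef : Fin M₀ → ℝ, ∀ l, z l = ∑ c, coef c * C c l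

/-- Core orthogonality step: a vector in `ker B` whose `L_T`-image is annihilated by a spanning cycle
matrix vanishes (`ℓ_l > 0`). [cite: GrossEtAl2019, proof of Prop. 4] -/
theorem eq_zero_of_ker_of_cyc (hspan : E.SpansCycles C) (hℓ : ∀ l, 0 < E.ind l) {z : Fin M → ℝ}
    (hker : ∀ k : Fin N, ∑ l, E.inc k l * z l = 0) (hcyc : ∀ c, ∑ l, C c l * E.ind l * z l = 0) :
    z = 0 := by
  obtain ⟨coef, hz⟩ := hspan z hker
  -- `Σ_l ℓ_l z_l² = Σ_c coef_c (Σ_l C_cl ℓ_l z_l) = 0`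
  have hsum : (∑ l, E.ind l * z l ^ 2) = 0 := by
    calc (∑ l, E.ind l * z l ^ 2) = ∑ l, E.ind l * z l * ∑ c, coef c * C c l :=
          Finset.sum_congr rfl fun l _ => by rw [← hz l]; ring
      _ = ∑ c, coef c * ∑ l, C c l * E.ind l * z l := by
          simp only [Finset.mul_sum]
          rw [Finset.sum_comm]
          exact Finset.sum_congr rfl fun c _ => Finset.sum_congr rfl fun l _ => by ring
      _ = 0 := Finset.sum_eq_zero fun c _ => by rw [hcyc c, mul_zero]
  have hterm : ∀ l, 0 ≤ E.ind l * z l ^ 2 := fun l => by have := hℓ l; positivity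
  funext l
  have h0 := (Finset.sum_eq_zero_iff_of_nonneg fun l _ => hterm l).1 hsum l (Finset.mem_univ l)
  rcases mul_eq_zero.1 h0 with h | h
  · exact absurd h (hℓ l).ne'
  · simpa using (pow_eq_zero_iff (n := 2) (by norm_num)).1 h

/-- **Injectivity of `y ↦ (ℬy, B_nᵀL_T y)`** from a spanning cycle matrix and `ℓ_l > 0` — the
hypothesis `hinj` of `Wfun_eq_zero_iff` / `nu_eq_zero_iff`, in print's terms.
[cite: GrossEtAl2019, proof of Prop. 4 («W(y) is positive definite»)] -/
theorem dev_injective_of_spansCycles (hspan : E.SpansCycles C) (hℓ : ∀ l, 0 < E.ind l) :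
    ∀ y : LineState M, E.nodeCur y = 0 → (∀ c, E.cyc₁ C y c = 0 ∧ E.cyc₂ C y c = 0) → y = 0 := by
  intro y hB hc
  have h1 : ∀ k : Fin N, ∑ l, E.inc k l * y.1 l = 0 := fun k => by
    have := congrArg (fun u : DvocState N => u.1 k) hB
    simpa [nodeCur, nodeCur₁] using this
  have h2 : ∀ k : Fin N, ∑ l, E.inc k l * y.2 l = 0 := fun k => by
    have := congrArg (fun u : DvocState N => u.2 k) hB
    simpa [nodeCur, nodeCur₂] using this
  have z1 := E.eq_zero_of_ker_of_cyc C hspan hℓ h1 fun c => by simpa [cyc₁] using (hc c).1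
  have z2 := E.eq_zero_of_ker_of_cyc C hspan hℓ h2 fun c => by simpa [cyc₂] using (hc c).2
  exact Prod.ext z1 z2

/-- `ℓ_l > 0` from `ρ > 0` and `‖Y_l‖ > 0`. [cite: GrossEtAl2019, §II-A («r_l ∈ ℝ_{>0} and
ℓ_l ∈ ℝ_{>0}»)] -/
theorem ind_pos (hρ : 0 < E.ρ) {l : Fin M} (ha : 0 < E.a l) : 0 < E.ind l := by
  unfold ind res
  have := E.cκ_pos
  positivity

/-- **Proposition 4, first statement, in print's terms**: with a cycle matrix whose rows span
`ker B`, `ρ > 0` and `‖Y_l‖ > 0`, `W(y) = 0 ↔ y = 0` (and `W ≥ 0`, `Wfun_nonneg`): `W` is positive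
definite. [cite: GrossEtAl2019, Prop. 4] -/
theorem Wfun_eq_zero_iff_of_spansCycles (hspan : E.SpansCycles C) (hρ : 0 < E.ρ)
    (ha : ∀ l, 0 < E.a l) (y : LineState M) : E.Wfun C y = 0 ↔ y = 0 :=
  E.Wfun_eq_zero_iff C hρ (E.dev_injective_of_spansCycles C hspan fun l => E.ind_pos hρ (ha l)) y

/-- **Zero set of `ν` = `𝒯`** in print's terms (spanning cycle matrix, `0 < d < 1`, `ρ > 0`,
`‖Y_l‖ > 0`, `ηαα₁ > 0`, `v_k* ≠ 0`, `Λ ≠ 0`). [cite: GrossEtAl2019, eq. (16), (32) and Prop. 4] -/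
theorem nu_eq_zero_iff_of_spansCycles (hspan : E.SpansCycles C) (hΛ : W.Lam ≠ 0) (hρ : 0 < E.ρ)
    (ha : ∀ l, 0 < E.a l) {d α₁ : ℝ} (hd0 : 0 < d) (hd1 : d < 1) (hw : 0 < W.η * W.α * α₁)
    (hv : ∀ k, W.vref k ≠ 0) (x : DvocState N × LineState M) :
    E.nu W C d α₁ x = 0 ↔ E.InT W x :=
  E.nu_eq_zero_iff W C hΛ hρ hd0 hd1 hw hv
    (E.dev_injective_of_spansCycles C hspan fun l => E.ind_pos hρ (ha l)) x

end spanning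

end DvocLines

end Literature.MathematicalPhysics.PowerSystems
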